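import Literature.MathematicalPhysics.QuantumManyBody.PeriodicBoseGasPQ
import HarnessLib

/-!
# Fournais 2020, (2.25): proof of `Fournais2020_eq225` (Lemma 2.3 = [FournaisSolovej2020, Lemma B.2])

Topic `Literature/MathematicalPhysics/QuantumManyBody`, sibling of `PeriodicBoseGasSectorOps.lean`
and `PeriodicBoseGasPQ.lean` (provefact `Literature.MathematicalPhysics.QuantumManyBody.BoseGas.Fournais2020_condensation`). This file proves
the named fact `Fournais2020_eq225` (`Fournais2020_eq225_holds`): for `R/ℓ` small, on the
`n`-particle sector of the box `Λ(u)`,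
`-ρ_μ∑ᵢ∫w₁(xᵢ,y)dy + ½∑_{i≠j}w(xᵢ,xⱼ) ≥ A₂ + (n²/(2ℓ³))(8πa + ∫gω) - (ρ_μn/ℓ³ + ¼(ρ_μ - n/ℓ³)²)8πaℓ³ - Ca(ρ_μ + nℓ⁻³)(n₊ + 1)`
[Fournais2020, (2.25)], the form of Lemma 2.3 ("[FournaisSolovej2020, Lemma B.2] (where the
details of the proof can also be found)") used in (2.43). With it, the trust base of
`Fournais2020_condensation` (`PeriodicBoseGasReduction.lean`) shrinks to
`LSSY2005_scatteringSolution` and `Fournais2020_lemma24` (second quantisation).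

## The proof

The paper's route is Lemma 2.2 (the 16-term algebraic decomposition (2.16)–(2.21) of the
potential by `P + Q = 1` in each of the two particles of a pair) followed by (2.22): discard
`Q₄ʳᵉⁿ ≥ 0`, absorb `Q₃ʳᵉⁿ` into it by Cauchy–Schwarz, simplify the `0Q` terms by
"`PᵢF(xᵢ,y)Pᵢ = ℓ⁻³Pᵢ∫F(x,y)dx`", and Cauchy–Schwarz the one-`Q` terms against the `0Q` and
`2Q` terms; then (2.25) from (2.22) by (2.10) and `n₀ + n₊ = n`. We follow it per ordered pair
`(i,j)` in first quantisation, organised so that only the calculus of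
`PeriodicBoseGasPQ.lean` is needed:

1. **Pointwise** (`pointwise_pair_ineq`): with `pp = PᵢPⱼΦ`, `q = QⱼQᵢΦ` (the two functions
   in `a2Form`), `y = Φ - pp - q` and `t = ω(xᵢ-xⱼ)`, `w₁ = (1-t)w`, `w₂ = (1+t)w₁`:
   `w|Φ|² ≥ w₂|pp|² + 2w₁Re(conj(pp)q) + 2w₁Re(conj(pp)y) - 2w₁|y|²`, the difference being
   `w|t·pp + y + q|² + 2w₁|y|² ≥ 0` — Lemma 2.2 and the absorptions of (2.22) in one stroke.
   Integrated: `pair_master_ineq`.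
2. **`0Q`** (`integral_pairLoc₂_nbodyPP`, `integral_norm_sq_nbodyPP_ge`): `pp` sees neither `xᵢ`
   nor `xⱼ`, so `∫w₂(xᵢ,xⱼ)|pp|² = ℓ⁻⁶∬w₂‖pp‖² = ℓ⁻³(8πa + ∫gω)‖pp‖²` ((2.10)), and
   `‖PᵢPⱼΦ‖² ≥ ‖Φ‖² - ‖QⱼΦ‖² - ‖QᵢΦ‖²` (Pythagoras; this is `n₀(n₀-1) ≥ n² - Cn·n₊`); the
   attraction's `0Q` part is `8πaρ_μ‖PₖΦ‖² ≤ 8πaρ_μ‖Φ‖²` per particle (`integral_attr_split`).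
3. **`2Q`** (`integral_pairLoc₁_onePart_le`): `y = Pᵢ(QⱼΦ) + Pⱼ(QᵢΦ)` a.e., and
   `∫w₁(xᵢ,xⱼ)|Pᵢ(QⱼΦ)|² ≤ ℓ⁻³K₁‖QⱼΦ‖²`, `K₁ = sup_x∫w₁(y,x)dy ≤ 2‖χ‖²_∞8πa`.
4. **`1Q`** (`integral_pairLoc₁_cross_eq`, `sum_cross_comm`, `integral_oneQ_collect`,
   `integral_cs_oneQ`, `integral_norm_sq_oneQ_A_le`): integrating out the particle under `w₁`
   and removing the projection turns `∑_{i≠j}∫w₁Re(conj(pp)y)` into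
   `2ℓ⁻³∑ⱼ∑_{i≠j}∫U(xⱼ)Re(conj(PᵢPⱼΦ)QⱼΦ)` (`U = ∫w₁(·,y)dy`, after relabelling with
   `PⱼPᵢ = PᵢPⱼ` a.e.), which combines with the attraction's cross term into
   `2∑ⱼ∫U(xⱼ)Re(conj(A_j)QⱼΦ)`, `A_j = ℓ⁻³∑_{i≠j}PᵢPⱼΦ - ρ_μPⱼΦ = αPⱼΦ - ℓ⁻³∑_{i≠j}Qᵢ(PⱼΦ)`,
   `α = (n-1)/ℓ³ - ρ_μ`; Cauchy–Schwarz with `λ = ℓ³/(4n)` and `∫U(xⱼ)|A_j|² = 8πa‖A_j‖²`,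
   `‖A_j‖² ≤ α²‖PⱼΦ‖² + (2|α|ℓ⁻³ + (n-1)ℓ⁻⁶)∑_{i≠j}‖QᵢΦ‖²` (`Re⟨PⱼΦ, Qᵢ(PⱼΦ)⟩ = ‖Qᵢ(PⱼΦ)‖² ≥ 0`)
   produce exactly the `-¼(ρ_μ - (n-1)/ℓ³)²8πaℓ³` of (2.23).
5. **Arithmetic** (`eq225_coefN2`, `eq225_coefNp`, `eq225_combine`): `(ρ_μ - (n-1)/ℓ³)² ≤
   (ρ_μ - n/ℓ³)² + 2ρ_μ/ℓ³ + ℓ⁻⁶`, `∫gω ≤ 8πa`, and all errors are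
   `≤ Ca(ρ_μ + n/ℓ³)(n₊ + ‖Φ‖²)` with `C = 32π + 128π‖χ‖²_∞` (`c₁ = D`, `χ*χ ≥ ½` on `B̄(0,D)`).

The symmetry of `Φ` is not used; `n = 0` is trivial. No new definitions.

## References

* [Fournais2020] S. Fournais, *Length scales for BEC in the dilute Bose gas*, arXiv:2011.00309,
  EMS Ser. Congr. Rep. 18 (2021), doi:10.4171/ecr/18-1/7: (2.5), (2.8)–(2.10), (2.15),
  Lemma 2.2 (2.16)–(2.21), Lemma 2.3 (2.22)–(2.25), the remark preceding Lemma 2.3 (arXiv v2 p. 8).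
* [FournaisSolovej2020] S. Fournais, J. P. Solovej, *The energy of dilute Bose gases*,
  Ann. of Math. 192 (2020) 893–976: Lemma B.2.
-/

noncomputable section

open MeasureTheory
open scoped ENNReal NNReal ComplexConjugate

namespace Literature.MathematicalPhysics.QuantumManyBody.BoseGas

variable {n : ℕ} {ℓ : ℝ} {u : Space} {v : ℝ → ℝ≥0∞} {ω : Space → ℝ} {χ : Space → ℝ}

/-! ### The pointwise inequality behind Lemma 2.2 and (2.22) -/

/-- **The pointwise core of Lemmas 2.2–2.3.** For complex numbers `pp, y, q` (standing for
`PᵢPⱼΦ`, the one-`Q` part and `QⱼQᵢΦ` at a point), `w ≥ 0` and `t = ω(xᵢ - xⱼ) ∈ [0,1]`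
(`w₁ = (1-t)w`, `w₂ = (1-t²)w = (1+t)w₁`):
`w|pp + y + q|² - [w₂|pp|² + 2w₁Re(conj(pp)q) + 2w₁Re(conj(pp)y) - 2w₁|y|²] = w|t·pp + y + q|² + 2w₁|y|² ≥ 0`.
The bracket collects, per ordered pair, the `0Q` term, the `A₂` term, the `1Q` term and the
(negative) `2Q` error of (2.16)–(2.22); the discarded square is the `Q₄`-type positive term
with the Cauchy–Schwarz absorptions of `Q₃` already performed. [cite: Fournais2020, Lemma 2.2 (2.16)–(2.21), Lemma 2.3 (2.22)] -/
theorem pointwise_pair_ineq (pp y q : ℂ) {w t : ℝ} (hw : 0 ≤ w) (h1 : t ≤ 1) :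
    (1 + t) * ((1 - t) * w) * ‖pp‖ ^ 2 + 2 * (((1 - t) * w) * (conj pp * q).re) +
        2 * (((1 - t) * w) * (conj pp * y).re) - 2 * (((1 - t) * w) * ‖y‖ ^ 2) ≤
      w * ‖pp + y + q‖ ^ 2 := by
  have key : w * ‖pp + y + q‖ ^ 2 - ((1 + t) * ((1 - t) * w) * ‖pp‖ ^ 2 +
      2 * (((1 - t) * w) * (conj pp * q).re) + 2 * (((1 - t) * w) * (conj pp * y).re) -
        2 * (((1 - t) * w) * ‖y‖ ^ 2)) =
      w * ‖(t : ℂ) * pp + y + q‖ ^ 2 + 2 * ((1 - t) * w) * ‖y‖ ^ 2 := by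
    simp only [Complex.sq_norm, Complex.normSq_apply, Complex.mul_re, Complex.mul_im, Complex.conj_re,
      Complex.conj_im, Complex.add_re, Complex.add_im, Complex.ofReal_re, Complex.ofReal_im]
    ring
  nlinarith [key, mul_nonneg hw (sq_nonneg ‖(t : ℂ) * pp + y + q‖),
    mul_nonneg (mul_nonneg (by linarith : (0 : ℝ) ≤ 1 - t) hw) (sq_nonneg ‖y‖)]

/-- **Cauchy–Schwarz for the one-`Q` terms**: `2U Re(conj(a) b) ≥ -λU|a|² - λ⁻¹U|b|²` for
`U ≥ 0`, `λ > 0`. [cite: Fournais2020, proof of Lemma 2.3 ("a Cauchy-Schwarz inequality on the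
terms with one `Q`")] -/
theorem two_mul_re_ge (a b : ℂ) {U lam : ℝ} (hU : 0 ≤ U) (hlam : 0 < lam) :
    -(lam * (U * ‖a‖ ^ 2)) - lam⁻¹ * (U * ‖b‖ ^ 2) ≤ 2 * (U * (conj a * b).re) := by
  have key : 2 * (U * (conj a * b).re) + lam * (U * ‖a‖ ^ 2) + lam⁻¹ * (U * ‖b‖ ^ 2) =
      U * lam⁻¹ * ‖(lam : ℂ) * a + b‖ ^ 2 := by
    simp only [Complex.sq_norm, Complex.normSq_apply, Complex.mul_re, Complex.mul_im, Complex.conj_re,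
      Complex.conj_im, Complex.add_re, Complex.add_im, Complex.ofReal_re, Complex.ofReal_im]
    field_simp
    ring
  nlinarith [key, mul_nonneg (mul_nonneg hU (inv_pos.mpr hlam).le) (sq_nonneg ‖(lam : ℂ) * a + b‖)]

/-! ### The weights `w, w₁, w₂ = w₁(1 + ω)` of the box: marginals and bounds -/

section Weights

/-- `(x,y) ↦ w₂(x,y) = w₁(x,y)(1 + ω(x-y))` is measurable. [cite: Fournais2020, (2.9)] -/
theorem measurable_pairLoc₂_uncurry (hvm : Measurable v) (hω : Measurable ω)
    (hχ : IsLocalizationFunction χ) (ℓ : ℝ) (u : Space) :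
    Measurable fun p : Space × Space =>
      pairLoc₁ v ω χ ℓ u p.1 p.2 * ENNReal.ofReal (1 + ω (p.1 - p.2)) :=
  (measurable_pairLoc₁₂ hvm hω hχ ℓ u).mul
    ((measurable_const.add (hω.comp (measurable_fst.sub measurable_snd))).ennreal_ofReal)

/-- `w₁.toReal = (1 - ω) w.toReal`. [cite: Fournais2020, (2.8)] -/
theorem toReal_pairLoc₁ (hω : IsScatteringSolution v ω) (χ : Space → ℝ) (ℓ : ℝ) (u x y : Space) :
    (pairLoc₁ v ω χ ℓ u x y).toReal = (1 - ω (x - y)) * (pairLoc v χ ℓ u x y).toReal := by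
  rw [pairLoc₁_eq_pairLoc_mul, ENNReal.toReal_mul, ENNReal.toReal_ofReal (by linarith [hω.le_one (x - y)]),
    mul_comm]

/-- `w₂.toReal = (1 + ω) w₁.toReal`. [cite: Fournais2020, (2.9)] -/
theorem toReal_pairLoc₂ (hω : IsScatteringSolution v ω) (χ : Space → ℝ) (ℓ : ℝ) (u x y : Space) :
    (pairLoc₁ v ω χ ℓ u x y * ENNReal.ofReal (1 + ω (x - y))).toReal =
      (1 + ω (x - y)) * (pairLoc₁ v ω χ ℓ u x y).toReal := by
  rw [ENNReal.toReal_mul, ENNReal.toReal_ofReal (by linarith [hω.nonneg (x - y)]), mul_comm]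

/-- The marginal bound for `w`: `∫_Λ w(y,x) dy ≤ 2‖χ‖²_∞ ∫v`. [cite: Fournais2020, (2.8)] -/
theorem kbound_pairLoc (hχ : IsLocalizationFunction χ) {R D Cχ : ℝ} (hR : ∀ r, R < r → v r = 0)
    (hℓ : 0 < ℓ) (hCχ : ∀ x, ‖χ x‖ ≤ Cχ) (hD : ∀ y : Space, ‖y‖ ≤ D → 2⁻¹ ≤ selfConv χ y)
    (hRℓ : R / ℓ ≤ D) (x : Space) :
    ∫⁻ y in slidingBox ℓ u, pairLoc v χ ℓ u y x ≤
      ENNReal.ofReal Cχ * ENNReal.ofReal Cχ * 2 * ∫⁻ z : Space, v ‖z‖ := by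
  calc ∫⁻ y in slidingBox ℓ u, pairLoc v χ ℓ u y x ≤ ∫⁻ y, pairLoc v χ ℓ u y x :=
        lintegral_mono' Measure.restrict_le_self le_rfl
    _ = ∫⁻ y, pairLoc v χ ℓ u x y := lintegral_congr fun y => pairLoc_comm hχ ℓ u y x
    _ ≤ _ := lintegral_pairLoc_le hR hℓ hCχ hD hRℓ x

/-- The marginal bound for `w₁`: `∫_Λ w₁(y,x) dy ≤ 2‖χ‖²_∞ 8πa`. [cite: Fournais2020, (2.8), (2.10)] -/
theorem kbound_pairLoc₁ (hω : IsScatteringSolution v ω) (hχ : IsLocalizationFunction χ) {R D Cχ : ℝ}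
    (hR : ∀ r, R < r → v r = 0) (hℓ : 0 < ℓ) (hCχ : ∀ x, ‖χ x‖ ≤ Cχ)
    (hD : ∀ y : Space, ‖y‖ ≤ D → 2⁻¹ ≤ selfConv χ y) (hRℓ : R / ℓ ≤ D) (x : Space) :
    ∫⁻ y in slidingBox ℓ u, pairLoc₁ v ω χ ℓ u y x ≤
      ENNReal.ofReal Cχ * ENNReal.ofReal Cχ * 2 * (ENNReal.ofReal (8 * Real.pi) * scatteringLength v) := by
  calc ∫⁻ y in slidingBox ℓ u, pairLoc₁ v ω χ ℓ u y x ≤ ∫⁻ y, pairLoc₁ v ω χ ℓ u y x :=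
        lintegral_mono' Measure.restrict_le_self le_rfl
    _ = ∫⁻ y, pairLoc₁ v ω χ ℓ u x y := lintegral_congr fun y => pairLoc₁_comm hω hχ ℓ u y x
    _ ≤ _ := lintegral_pairLoc₁_le hω hR hℓ hCχ hD hRℓ x

/-- The marginal bound for `w₂ ≤ 2w₁`: `∫_Λ w₂(y,x) dy ≤ 2 · 2‖χ‖²_∞ 8πa`. [cite: Fournais2020, (2.9)] -/
theorem kbound_pairLoc₂ (hω : IsScatteringSolution v ω) (hχ : IsLocalizationFunction χ) {R D Cχ : ℝ}
    (hR : ∀ r, R < r → v r = 0) (hℓ : 0 < ℓ) (hCχ : ∀ x, ‖χ x‖ ≤ Cχ)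
    (hD : ∀ y : Space, ‖y‖ ≤ D → 2⁻¹ ≤ selfConv χ y) (hRℓ : R / ℓ ≤ D) (x : Space) :
    ∫⁻ y in slidingBox ℓ u, pairLoc₁ v ω χ ℓ u y x * ENNReal.ofReal (1 + ω (y - x)) ≤
      2 * (ENNReal.ofReal Cχ * ENNReal.ofReal Cχ * 2 *
        (ENNReal.ofReal (8 * Real.pi) * scatteringLength v)) := by
  calc ∫⁻ y in slidingBox ℓ u, pairLoc₁ v ω χ ℓ u y x * ENNReal.ofReal (1 + ω (y - x))
      ≤ ∫⁻ y in slidingBox ℓ u, pairLoc₁ v ω χ ℓ u y x * 2 := by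
        refine lintegral_mono fun y => ?_
        gcongr
        calc ENNReal.ofReal (1 + ω (y - x)) ≤ ENNReal.ofReal 2 :=
              ENNReal.ofReal_le_ofReal (by linarith [hω.le_one (y - x)])
          _ = 2 := ENNReal.ofReal_ofNat 2
    _ = 2 * ∫⁻ y in slidingBox ℓ u, pairLoc₁ v ω χ ℓ u y x := by
        rw [lintegral_mul_const' _ _ ENNReal.ofNat_ne_top, mul_comm]
    _ ≤ _ := by
        gcongr
        exact kbound_pairLoc₁ hω hχ hR hℓ hCχ hD hRℓ x

/-- `∫_Λ w₁(y,x) dy = ∫ w₁(x,y) dy` (support and symmetry): the marginal produced by integrating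
out a particle is the one-body potential `∫w₁(x,y)dy` of (2.6). [cite: Fournais2020, (2.6), (2.8)] -/
theorem setLIntegral_pairLoc₁_swap (hω : IsScatteringSolution v ω) (hχ : IsLocalizationFunction χ)
    (hℓ : 0 < ℓ) (u x : Space) :
    ∫⁻ y in slidingBox ℓ u, pairLoc₁ v ω χ ℓ u y x = ∫⁻ y, pairLoc₁ v ω χ ℓ u x y := by
  rw [setLIntegral_slidingBox_eq (fun y hy => pairLoc₁_eq_zero_of_not_mem hχ hℓ hy x)]
  exact lintegral_congr fun y => pairLoc₁_comm hω hχ ℓ u y x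

/-- A single pair potential is dominated by the total repulsion: `w(xᵢ,xⱼ) ≤ ∑_{k<l} w(x_k,x_l)`
(`i ≠ j`; `w` symmetric). [cite: Fournais2020, (2.6)] -/
theorem pairLoc_le_repBoxN {N : ℕ} (hχ : IsLocalizationFunction χ) (ℓ : ℝ) (u : Space)
    {i j : Fin N} (hij : i ≠ j) (X : Config N) :
    pairLoc v χ ℓ u (X i) (X j) ≤ repBoxN v χ ℓ u X := by
  unfold repBoxN
  rcases lt_or_gt_of_ne hij with h | h
  · calc pairLoc v χ ℓ u (X i) (X j)
        ≤ ∑ l : Fin N with i < l, pairLoc v χ ℓ u (X i) (X l) :=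
          Finset.single_le_sum (f := fun l => pairLoc v χ ℓ u (X i) (X l)) (fun _ _ => zero_le)
            (Finset.mem_filter.mpr ⟨Finset.mem_univ _, h⟩)
      _ ≤ ∑ k : Fin N, ∑ l : Fin N with k < l, pairLoc v χ ℓ u (X k) (X l) :=
          Finset.single_le_sum (f := fun k => ∑ l : Fin N with k < l, pairLoc v χ ℓ u (X k) (X l))
            (fun _ _ => zero_le) (Finset.mem_univ i)
  · rw [pairLoc_comm hχ]
    calc pairLoc v χ ℓ u (X j) (X i)
        ≤ ∑ l : Fin N with j < l, pairLoc v χ ℓ u (X j) (X l) :=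
          Finset.single_le_sum (f := fun l => pairLoc v χ ℓ u (X j) (X l)) (fun _ _ => zero_le)
            (Finset.mem_filter.mpr ⟨Finset.mem_univ _, h⟩)
      _ ≤ ∑ k : Fin N, ∑ l : Fin N with k < l, pairLoc v χ ℓ u (X k) (X l) :=
          Finset.single_le_sum (f := fun k => ∑ l : Fin N with k < l, pairLoc v χ ℓ u (X k) (X l))
            (fun _ _ => zero_le) (Finset.mem_univ j)

end Weights

/-! ### Finiteness of the weighted norms `∫ w(xᵢ,xⱼ)|G|²` -/

section Finiteness

variable {i j : Fin (n + 1)} {w : Space → Space → ℝ≥0∞} {K : ℝ≥0∞}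

/-- `∫ w(xᵢ,xⱼ)|G|² ≤ ℓ⁻³K‖G‖²` for `G` not depending on `xⱼ` (symmetric `w`). [cite: Fournais2020, remark preceding Lemma 2.3] -/
theorem lintegral_pairWeight_mul_le_right (hℓ : 0 < ℓ) (hij : i ≠ j)
    (hw : Measurable fun p : Space × Space => w p.1 p.2) (hsymm : ∀ x y, w x y = w y x)
    (hK : ∀ x, ∫⁻ y in slidingBox ℓ u, w y x ≤ K)
    {G : Config (n + 1) → ℝ≥0∞} (hGm : Measurable G) (hG : ∀ X y, G (Function.update X j y) = G X) :
    ∫⁻ X in boxConfig (n + 1) ℓ u, w (X i) (X j) * G X ≤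
      (ENNReal.ofReal ℓ ^ 3)⁻¹ * K * ∫⁻ X in boxConfig (n + 1) ℓ u, G X := by
  calc ∫⁻ X in boxConfig (n + 1) ℓ u, w (X i) (X j) * G X
      = ∫⁻ X in boxConfig (n + 1) ℓ u, w (X j) (X i) * G X := lintegral_congr fun X => by rw [hsymm]
    _ ≤ _ := lintegral_pairWeight_mul_le hℓ hij.symm hw hK hGm hG

/-- **Finiteness, left**: `∫ w(xᵢ,xⱼ)|G|² < ∞` for `G ∈ L²` not depending on `xᵢ`.
[cite: Fournais2020, remark preceding Lemma 2.3] -/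
theorem lintegral_pairWeight_norm_sq_ne_top_left (hℓ : 0 < ℓ) (hij : i ≠ j)
    (hw : Measurable fun p : Space × Space => w p.1 p.2) (hK : ∀ x, ∫⁻ y in slidingBox ℓ u, w y x ≤ K) (hK' : K ≠ ⊤)
    {G : Config (n + 1) → ℂ} (hGm : Measurable G) (hG : ∀ X y, G (Function.update X i y) = G X)
    (hG2 : MemLp G 2 (volume.restrict (boxConfig (n + 1) ℓ u))) :
    ∫⁻ X in boxConfig (n + 1) ℓ u, w (X i) (X j) * (‖G X‖₊ : ℝ≥0∞) ^ 2 ≠ ⊤ := by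
  have hℓ3 : ENNReal.ofReal ℓ ^ 3 ≠ 0 := pow_ne_zero _ (by rwa [Ne, ENNReal.ofReal_eq_zero, not_le])
  refine ne_top_of_le_ne_top ?_ (lintegral_pairWeight_mul_le hℓ hij hw hK
    (hGm.nnnorm.coe_nnreal_ennreal.pow_const _) (fun X y => by rw [hG]))
  exact ENNReal.mul_ne_top (ENNReal.mul_ne_top (ENNReal.inv_ne_top.mpr hℓ3) hK')
    (lintegral_ne_top_of_memLp_two hG2)

/-- **Finiteness, right**: `∫ w(xᵢ,xⱼ)|G|² < ∞` for `G ∈ L²` not depending on `xⱼ`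
(symmetric `w`). [cite: Fournais2020, remark preceding Lemma 2.3] -/
theorem lintegral_pairWeight_norm_sq_ne_top_right (hℓ : 0 < ℓ) (hij : i ≠ j)
    (hw : Measurable fun p : Space × Space => w p.1 p.2) (hsymm : ∀ x y, w x y = w y x)
    (hK : ∀ x, ∫⁻ y in slidingBox ℓ u, w y x ≤ K) (hK' : K ≠ ⊤)
    {G : Config (n + 1) → ℂ} (hGm : Measurable G) (hG : ∀ X y, G (Function.update X j y) = G X)
    (hG2 : MemLp G 2 (volume.restrict (boxConfig (n + 1) ℓ u))) :
    ∫⁻ X in boxConfig (n + 1) ℓ u, w (X i) (X j) * (‖G X‖₊ : ℝ≥0∞) ^ 2 ≠ ⊤ := by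
  have hℓ3 : ENNReal.ofReal ℓ ^ 3 ≠ 0 := pow_ne_zero _ (by rwa [Ne, ENNReal.ofReal_eq_zero, not_le])
  refine ne_top_of_le_ne_top ?_ (lintegral_pairWeight_mul_le_right hℓ hij hw hsymm hK
    (hGm.nnnorm.coe_nnreal_ennreal.pow_const _) (fun X y => by rw [hG]))
  exact ENNReal.mul_ne_top (ENNReal.mul_ne_top (ENNReal.inv_ne_top.mpr hℓ3) hK')
    (lintegral_ne_top_of_memLp_two hG2)

/-- A smaller weight inherits finiteness. [folklore] -/
theorem lintegral_mul_norm_sq_ne_top_mono {α : Type*} [MeasurableSpace α] {μ : Measure α}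
    {W W' : α → ℝ≥0∞} (hle : ∀ x, W' x ≤ W x) {G : α → ℂ}
    (h : ∫⁻ x, W x * (‖G x‖₊ : ℝ≥0∞) ^ 2 ∂μ ≠ ⊤) : ∫⁻ x, W' x * (‖G x‖₊ : ℝ≥0∞) ^ 2 ∂μ ≠ ⊤ :=
  ne_top_of_le_ne_top h (lintegral_mono fun x => mul_le_mul' (hle x) le_rfl)

/-- `w₂ ≤ 2w`. [cite: Fournais2020, (2.9)] -/
theorem pairLoc₂_le_two_mul (hω : IsScatteringSolution v ω) (χ : Space → ℝ) (ℓ : ℝ) (u x y : Space) :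
    pairLoc₁ v ω χ ℓ u x y * ENNReal.ofReal (1 + ω (x - y)) ≤ 2 * pairLoc v χ ℓ u x y := by
  calc pairLoc₁ v ω χ ℓ u x y * ENNReal.ofReal (1 + ω (x - y)) ≤ pairLoc v χ ℓ u x y * 2 := by
        gcongr
        · exact pairLoc₁_le_pairLoc hω χ ℓ u x y
        · calc ENNReal.ofReal (1 + ω (x - y)) ≤ ENNReal.ofReal 2 :=
              ENNReal.ofReal_le_ofReal (by linarith [hω.le_one (x - y)])
            _ = 2 := ENNReal.ofReal_ofNat 2
    _ = _ := mul_comm _ _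

/-- Finiteness for `2w` from finiteness for `w`. [folklore] -/
theorem lintegral_two_mul_norm_sq_ne_top {α : Type*} [MeasurableSpace α] {μ : Measure α}
    {W : α → ℝ≥0∞} {G : α → ℂ} (h : ∫⁻ x, W x * (‖G x‖₊ : ℝ≥0∞) ^ 2 ∂μ ≠ ⊤) :
    ∫⁻ x, 2 * W x * (‖G x‖₊ : ℝ≥0∞) ^ 2 ∂μ ≠ ⊤ := by
  have h1 : ∫⁻ x, 2 * W x * (‖G x‖₊ : ℝ≥0∞) ^ 2 ∂μ = 2 * ∫⁻ x, W x * (‖G x‖₊ : ℝ≥0∞) ^ 2 ∂μ := by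
    rw [← lintegral_const_mul' _ _ ENNReal.ofNat_ne_top]
    exact lintegral_congr fun x => by ring
  rw [h1]
  exact ENNReal.mul_ne_top ENNReal.ofNat_ne_top h

end Finiteness

/-! ### The integrated pair inequality -/

section PairMaster

variable {i j : Fin (n + 1)} {Φ : Config (n + 1) → ℂ} {K : ℝ≥0∞}

/-- `QⱼQᵢΦ = Φ - PᵢΦ - Pⱼ(QᵢΦ)` pointwise. [cite: Fournais2020, (2.5), (2.15)] -/
theorem nbodyQ_nbodyQ_eq (ℓ : ℝ) (u : Space) (i j : Fin (n + 1)) (Φ : Config (n + 1) → ℂ)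
    (X : Config (n + 1)) :
    nbodyQ ℓ u j (nbodyQ ℓ u i Φ) X = Φ X - nbodyP ℓ u i Φ X - nbodyP ℓ u j (nbodyQ ℓ u i Φ) X := by
  simp only [nbodyQ]

/-- **Finiteness of `∫ w|QⱼQᵢΦ|²`.** [cite: Fournais2020, (2.22)] -/
theorem lintegral_pairLoc_nbodyQQ_ne_top (hℓ : 0 < ℓ) (hχ : IsLocalizationFunction χ)
    (hvm : Measurable v) (hK : ∀ x, ∫⁻ y in slidingBox ℓ u, pairLoc v χ ℓ u y x ≤ K) (hK' : K ≠ ⊤)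
    (hΦm : Measurable Φ) (hΦ2 : MemLp Φ 2 (volume.restrict (boxConfig (n + 1) ℓ u))) (hij : i ≠ j)
    (hfin : ∫⁻ X in boxConfig (n + 1) ℓ u, pairLoc v χ ℓ u (X i) (X j) * (‖Φ X‖₊ : ℝ≥0∞) ^ 2 ≠ ⊤) :
    ∫⁻ X in boxConfig (n + 1) ℓ u, pairLoc v χ ℓ u (X i) (X j) *
      (‖nbodyQ ℓ u j (nbodyQ ℓ u i Φ) X‖₊ : ℝ≥0∞) ^ 2 ≠ ⊤ := by
  have hw := measurable_pairLoc₂ hvm hχ ℓ u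
  have hπ : Measurable fun X : Config (n + 1) => (X i, X j) :=
    (measurable_pi_apply i).prodMk (measurable_pi_apply j)
  have hwij : AEMeasurable (fun X : Config (n + 1) => pairLoc v χ ℓ u (X i) (X j))
      (volume.restrict (boxConfig (n + 1) ℓ u)) := (hw.comp hπ).aemeasurable
  have hPi := memLp_nbodyP hℓ i hΦm hΦ2
  have hQi := memLp_nbodyQ hℓ i hΦm hΦ2
  have hQim := measurable_nbodyQ ℓ u i hΦm
  have hPjQi := memLp_nbodyP hℓ j hQim hQi
  have h1 : ∫⁻ X in boxConfig (n + 1) ℓ u, pairLoc v χ ℓ u (X i) (X j) *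
      (‖nbodyP ℓ u i Φ X‖₊ : ℝ≥0∞) ^ 2 ≠ ⊤ :=
    lintegral_pairWeight_norm_sq_ne_top_left hℓ hij hw hK hK' (measurable_nbodyP ℓ u i hΦm)
      (fun X y => nbodyP_update ℓ u i Φ X y) hPi
  have h2 : ∫⁻ X in boxConfig (n + 1) ℓ u, pairLoc v χ ℓ u (X i) (X j) *
      (‖nbodyP ℓ u j (nbodyQ ℓ u i Φ) X‖₊ : ℝ≥0∞) ^ 2 ≠ ⊤ :=
    lintegral_pairWeight_norm_sq_ne_top_right hℓ hij hw (fun x y => pairLoc_comm hχ ℓ u x y) hK hK'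
      (measurable_nbodyP ℓ u j hQim) (fun X y => nbodyP_update ℓ u j (nbodyQ ℓ u i Φ) X y) hPjQi
  simp only [nbodyQ_nbodyQ_eq]
  refine ne_top_of_le_ne_top ?_ (lintegral_mul_norm_sq_sub_le hwij
    (a := fun X => Φ X - nbodyP ℓ u i Φ X) (hΦ2.1.sub (measurable_nbodyP ℓ u i hΦm).aestronglyMeasurable)
    (fun X => nbodyP ℓ u j (nbodyQ ℓ u i Φ) X))
  refine ENNReal.add_ne_top.mpr ⟨ENNReal.mul_ne_top ENNReal.ofNat_ne_top ?_,
    ENNReal.mul_ne_top ENNReal.ofNat_ne_top h2⟩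
  refine ne_top_of_le_ne_top ?_ (lintegral_mul_norm_sq_sub_le hwij (a := Φ) hΦ2.1 (nbodyP ℓ u i Φ))
  exact ENNReal.add_ne_top.mpr ⟨ENNReal.mul_ne_top ENNReal.ofNat_ne_top hfin,
    ENNReal.mul_ne_top ENNReal.ofNat_ne_top h1⟩

/-- **Finiteness of `∫ w|PᵢPⱼΦ|²`.** [cite: Fournais2020, (2.22)] -/
theorem lintegral_pairLoc_nbodyPP_ne_top (hℓ : 0 < ℓ) (hχ : IsLocalizationFunction χ)
    (hvm : Measurable v) (hK : ∀ x, ∫⁻ y in slidingBox ℓ u, pairLoc v χ ℓ u y x ≤ K) (hK' : K ≠ ⊤)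
    (hΦm : Measurable Φ) (hΦ2 : MemLp Φ 2 (volume.restrict (boxConfig (n + 1) ℓ u))) (hij : i ≠ j) :
    ∫⁻ X in boxConfig (n + 1) ℓ u, pairLoc v χ ℓ u (X i) (X j) *
      (‖nbodyP ℓ u i (nbodyP ℓ u j Φ) X‖₊ : ℝ≥0∞) ^ 2 ≠ ⊤ :=
  lintegral_pairWeight_norm_sq_ne_top_left hℓ hij (measurable_pairLoc₂ hvm hχ ℓ u) hK hK'
    (measurable_nbodyP ℓ u i (measurable_nbodyP ℓ u j hΦm)) (fun X y => nbodyP_update ℓ u i (nbodyP ℓ u j Φ) X y)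
    (memLp_nbodyP hℓ i (measurable_nbodyP ℓ u j hΦm) (memLp_nbodyP hℓ j hΦm hΦ2))

/-- **Finiteness of `∫ w|y|²`** for the one-`Q` part `y = Φ - PᵢPⱼΦ - QⱼQᵢΦ`. [cite: Fournais2020, (2.22)] -/
theorem lintegral_pairLoc_onePart_ne_top (hℓ : 0 < ℓ) (hχ : IsLocalizationFunction χ)
    (hvm : Measurable v) (hK : ∀ x, ∫⁻ y in slidingBox ℓ u, pairLoc v χ ℓ u y x ≤ K) (hK' : K ≠ ⊤)
    (hΦm : Measurable Φ) (hΦ2 : MemLp Φ 2 (volume.restrict (boxConfig (n + 1) ℓ u))) (hij : i ≠ j)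
    (hfin : ∫⁻ X in boxConfig (n + 1) ℓ u, pairLoc v χ ℓ u (X i) (X j) * (‖Φ X‖₊ : ℝ≥0∞) ^ 2 ≠ ⊤) :
    ∫⁻ X in boxConfig (n + 1) ℓ u, pairLoc v χ ℓ u (X i) (X j) *
      (‖Φ X - nbodyP ℓ u i (nbodyP ℓ u j Φ) X - nbodyQ ℓ u j (nbodyQ ℓ u i Φ) X‖₊ : ℝ≥0∞) ^ 2 ≠ ⊤ := by
  have hw := measurable_pairLoc₂ hvm hχ ℓ u
  have hπ : Measurable fun X : Config (n + 1) => (X i, X j) :=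
    (measurable_pi_apply i).prodMk (measurable_pi_apply j)
  have hwij : AEMeasurable (fun X : Config (n + 1) => pairLoc v χ ℓ u (X i) (X j))
      (volume.restrict (boxConfig (n + 1) ℓ u)) := (hw.comp hπ).aemeasurable
  have hpp := lintegral_pairLoc_nbodyPP_ne_top hℓ hχ hvm hK hK' hΦm hΦ2 hij
  have hq := lintegral_pairLoc_nbodyQQ_ne_top hℓ hχ hvm hK hK' hΦm hΦ2 hij hfin
  refine ne_top_of_le_ne_top ?_ (lintegral_mul_norm_sq_sub_le hwij
    (a := fun X => Φ X - nbodyP ℓ u i (nbodyP ℓ u j Φ) X)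
    (hΦ2.1.sub (measurable_nbodyP ℓ u i (measurable_nbodyP ℓ u j hΦm)).aestronglyMeasurable)
    (nbodyQ ℓ u j (nbodyQ ℓ u i Φ)))
  refine ENNReal.add_ne_top.mpr ⟨ENNReal.mul_ne_top ENNReal.ofNat_ne_top ?_,
    ENNReal.mul_ne_top ENNReal.ofNat_ne_top hq⟩
  refine ne_top_of_le_ne_top ?_ (lintegral_mul_norm_sq_sub_le hwij (a := Φ) hΦ2.1
    (nbodyP ℓ u i (nbodyP ℓ u j Φ)))
  exact ENNReal.add_ne_top.mpr ⟨ENNReal.mul_ne_top ENNReal.ofNat_ne_top hfin,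
    ENNReal.mul_ne_top ENNReal.ofNat_ne_top hpp⟩

/-- **The pair inequality, integrated over `Λⁿ⁺¹`**: for `i ≠ j`, with `pp = PᵢPⱼΦ`, `q = QⱼQᵢΦ`
and `y = Φ - pp - q`,
`∫ w₂|pp|² + 2∫ w₁Re(conj(pp)q) + 2∫ w₁Re(conj(pp)y) - 2∫ w₁|y|² ≤ ∫ w(xᵢ,xⱼ)|Φ|²`.
[cite: Fournais2020, Lemma 2.2 (2.16), Lemma 2.3 (2.22)] -/
theorem pair_master_ineq (hℓ : 0 < ℓ) (hω : IsScatteringSolution v ω) (hχ : IsLocalizationFunction χ)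
    (hvm : Measurable v) (hK : ∀ x, ∫⁻ y in slidingBox ℓ u, pairLoc v χ ℓ u y x ≤ K) (hK' : K ≠ ⊤)
    (hΦm : Measurable Φ) (hΦ2 : MemLp Φ 2 (volume.restrict (boxConfig (n + 1) ℓ u))) (hij : i ≠ j)
    (hfin : ∫⁻ X in boxConfig (n + 1) ℓ u, pairLoc v χ ℓ u (X i) (X j) * (‖Φ X‖₊ : ℝ≥0∞) ^ 2 ≠ ⊤) :
    (∫ X in boxConfig (n + 1) ℓ u,
        (pairLoc₁ v ω χ ℓ u (X i) (X j) * ENNReal.ofReal (1 + ω (X i - X j))).toReal *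
          ‖nbodyP ℓ u i (nbodyP ℓ u j Φ) X‖ ^ 2) +
      2 * (∫ X in boxConfig (n + 1) ℓ u, (pairLoc₁ v ω χ ℓ u (X i) (X j)).toReal *
          (conj (nbodyP ℓ u i (nbodyP ℓ u j Φ) X) * nbodyQ ℓ u j (nbodyQ ℓ u i Φ) X).re) +
      2 * (∫ X in boxConfig (n + 1) ℓ u, (pairLoc₁ v ω χ ℓ u (X i) (X j)).toReal *
          (conj (nbodyP ℓ u i (nbodyP ℓ u j Φ) X) *
            (Φ X - nbodyP ℓ u i (nbodyP ℓ u j Φ) X - nbodyQ ℓ u j (nbodyQ ℓ u i Φ) X)).re) -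
      2 * (∫ X in boxConfig (n + 1) ℓ u, (pairLoc₁ v ω χ ℓ u (X i) (X j)).toReal *
          ‖Φ X - nbodyP ℓ u i (nbodyP ℓ u j Φ) X - nbodyQ ℓ u j (nbodyQ ℓ u i Φ) X‖ ^ 2) ≤
    ∫ X in boxConfig (n + 1) ℓ u, (pairLoc v χ ℓ u (X i) (X j)).toReal * ‖Φ X‖ ^ 2 := by
  set pp := nbodyP ℓ u i (nbodyP ℓ u j Φ) with hpp
  set q := nbodyQ ℓ u j (nbodyQ ℓ u i Φ) with hq
  -- measurability
  have hw := measurable_pairLoc₂ hvm hχ ℓ u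
  have hw₁ := measurable_pairLoc₁₂ hvm hω.measurable hχ ℓ u
  have hw₂ := measurable_pairLoc₂_uncurry hvm hω.measurable hχ ℓ u
  have hπ : Measurable fun X : Config (n + 1) => (X i, X j) :=
    (measurable_pi_apply i).prodMk (measurable_pi_apply j)
  have hwij : AEMeasurable (fun X : Config (n + 1) => pairLoc v χ ℓ u (X i) (X j))
      (volume.restrict (boxConfig (n + 1) ℓ u)) := (hw.comp hπ).aemeasurable
  have hw₁ij : AEMeasurable (fun X : Config (n + 1) => pairLoc₁ v ω χ ℓ u (X i) (X j))
      (volume.restrict (boxConfig (n + 1) ℓ u)) := (hw₁.comp hπ).aemeasurable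
  have hw₂ij : AEMeasurable (fun X : Config (n + 1) =>
      pairLoc₁ v ω χ ℓ u (X i) (X j) * ENNReal.ofReal (1 + ω (X i - X j)))
      (volume.restrict (boxConfig (n + 1) ℓ u)) := (hw₂.comp hπ).aemeasurable
  have hppm : Measurable pp := measurable_nbodyP ℓ u i (measurable_nbodyP ℓ u j hΦm)
  have hqm : Measurable q := measurable_nbodyQ ℓ u j (measurable_nbodyQ ℓ u i hΦm)
  have hym : Measurable fun X => Φ X - pp X - q X := (hΦm.sub hppm).sub hqm
  -- finiteness for the three weights
  have fpp := lintegral_pairLoc_nbodyPP_ne_top hℓ hχ hvm hK hK' hΦm hΦ2 hij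
  have fq := lintegral_pairLoc_nbodyQQ_ne_top hℓ hχ hvm hK hK' hΦm hΦ2 hij hfin
  have fy := lintegral_pairLoc_onePart_ne_top hℓ hχ hvm hK hK' hΦm hΦ2 hij hfin
  have mono₁ : ∀ X : Config (n + 1), pairLoc₁ v ω χ ℓ u (X i) (X j) ≤ pairLoc v χ ℓ u (X i) (X j) :=
    fun X => pairLoc₁_le_pairLoc hω χ ℓ u _ _
  have mono₂ : ∀ X : Config (n + 1), pairLoc₁ v ω χ ℓ u (X i) (X j) * ENNReal.ofReal (1 + ω (X i - X j)) ≤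
      2 * pairLoc v χ ℓ u (X i) (X j) := fun X => pairLoc₂_le_two_mul hω χ ℓ u _ _
  have fpp₂ := lintegral_mul_norm_sq_ne_top_mono mono₂ (lintegral_two_mul_norm_sq_ne_top fpp)
  have fpp₁ := lintegral_mul_norm_sq_ne_top_mono mono₁ fpp
  have fq₁ := lintegral_mul_norm_sq_ne_top_mono mono₁ fq
  have fy₁ := lintegral_mul_norm_sq_ne_top_mono mono₁ fy
  -- integrability of the five integrands
  have I1 := integrable_toReal_mul_norm_sq hw₂ij hppm.aestronglyMeasurable fpp₂
  have I2 := integrable_toReal_mul_re hw₁ij hppm.aestronglyMeasurable hqm.aestronglyMeasurable fpp₁ fq₁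
  have I3 := integrable_toReal_mul_re hw₁ij hppm.aestronglyMeasurable hym.aestronglyMeasurable fpp₁ fy₁
  have I4 := integrable_toReal_mul_norm_sq hw₁ij hym.aestronglyMeasurable fy₁
  have I5 := integrable_toReal_mul_norm_sq hwij hΦ2.1 hfin
  -- combine and compare pointwise
  set f1 : Config (n + 1) → ℝ := fun X =>
    (pairLoc₁ v ω χ ℓ u (X i) (X j) * ENNReal.ofReal (1 + ω (X i - X j))).toReal * ‖pp X‖ ^ 2 with hf1
  set f2 : Config (n + 1) → ℝ := fun X =>
    (pairLoc₁ v ω χ ℓ u (X i) (X j)).toReal * (conj (pp X) * q X).re with hf2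
  set f3 : Config (n + 1) → ℝ := fun X =>
    (pairLoc₁ v ω χ ℓ u (X i) (X j)).toReal * (conj (pp X) * (Φ X - pp X - q X)).re with hf3
  set f4 : Config (n + 1) → ℝ := fun X =>
    (pairLoc₁ v ω χ ℓ u (X i) (X j)).toReal * ‖Φ X - pp X - q X‖ ^ 2 with hf4
  set f5 : Config (n + 1) → ℝ := fun X => (pairLoc v χ ℓ u (X i) (X j)).toReal * ‖Φ X‖ ^ 2 with hf5
  have I123 : Integrable (fun X => f1 X + 2 * f2 X + 2 * f3 X) (volume.restrict (boxConfig (n + 1) ℓ u)) :=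
    (I1.add (I2.const_mul 2)).add (I3.const_mul 2)
  have hsum : ∫ X in boxConfig (n + 1) ℓ u, (f1 X + 2 * f2 X + 2 * f3 X - 2 * f4 X) =
      (∫ X in boxConfig (n + 1) ℓ u, f1 X) + 2 * (∫ X in boxConfig (n + 1) ℓ u, f2 X) +
        2 * (∫ X in boxConfig (n + 1) ℓ u, f3 X) - 2 * (∫ X in boxConfig (n + 1) ℓ u, f4 X) := by
    rw [integral_sub (f := fun X => f1 X + 2 * f2 X + 2 * f3 X) (g := fun X => 2 * f4 X) I123
        (I4.const_mul 2),
      integral_add (f := fun X => f1 X + 2 * f2 X) (g := fun X => 2 * f3 X) (I1.add (I2.const_mul 2))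
        (I3.const_mul 2),
      integral_add (f := f1) (g := fun X => 2 * f2 X) I1 (I2.const_mul 2),
      integral_const_mul, integral_const_mul, integral_const_mul]
  have hmain : ∫ X in boxConfig (n + 1) ℓ u, (f1 X + 2 * f2 X + 2 * f3 X - 2 * f4 X) ≤
      ∫ X in boxConfig (n + 1) ℓ u, f5 X := by
    refine integral_mono (I123.sub (I4.const_mul 2)) I5 fun X => ?_
    have hΦX : Φ X = pp X + (Φ X - pp X - q X) + q X := by ring
    simp only [hf1, hf2, hf3, hf4, hf5, toReal_pairLoc₂ hω, toReal_pairLoc₁ hω]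
    conv_rhs => rw [hΦX]
    have h := pointwise_pair_ineq (pp X) (Φ X - pp X - q X) (q X)
      (w := (pairLoc v χ ℓ u (X i) (X j)).toReal) (t := ω (X i - X j)) ENNReal.toReal_nonneg
      (hω.le_one _)
    linarith [h]
  linarith [hmain, hsum]

end PairMaster

/-! ### The `0Q` term: `∫ w₂(xᵢ,xⱼ)|PᵢPⱼΦ|² = ℓ⁻³(8πa + ∫gω)‖PᵢPⱼΦ‖²` and `‖PᵢPⱼΦ‖² ≥ ‖Φ‖² - ‖QᵢΦ‖² - ‖QⱼΦ‖²` -/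

section ZeroQ

variable {i j : Fin (n + 1)} {Φ : Config (n + 1) → ℂ}

/-- **`∫ ω(xᵢ,xⱼ)|PᵢPⱼΦ|² = ℓ⁻⁶ (∫_Λ∫_Λ ω) ‖PᵢPⱼΦ‖²`**: `PᵢPⱼΦ` sees neither `xᵢ` nor `xⱼ`, so both
can be integrated out of the weight. [cite: Fournais2020, remark preceding Lemma 2.3, (2.21), (2.23)] -/
theorem lintegral_pairWeight_nbodyPP (hℓ : 0 < ℓ) (hij : i ≠ j) {w : Space → Space → ℝ≥0∞}
    (hw : Measurable fun p : Space × Space => w p.1 p.2) (hΦm : Measurable Φ) :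
    ∫⁻ X in boxConfig (n + 1) ℓ u, w (X i) (X j) * (‖nbodyP ℓ u i (nbodyP ℓ u j Φ) X‖₊ : ℝ≥0∞) ^ 2 =
      (ENNReal.ofReal ℓ ^ 3)⁻¹ * (ENNReal.ofReal ℓ ^ 3)⁻¹ *
        (∫⁻ x in slidingBox ℓ u, ∫⁻ y in slidingBox ℓ u, w y x) *
        ∫⁻ X in boxConfig (n + 1) ℓ u, (‖nbodyP ℓ u i (nbodyP ℓ u j Φ) X‖₊ : ℝ≥0∞) ^ 2 := by
  have hppm : Measurable fun X => (‖nbodyP ℓ u i (nbodyP ℓ u j Φ) X‖₊ : ℝ≥0∞) ^ 2 :=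
    (measurable_nbodyP ℓ u i (measurable_nbodyP ℓ u j hΦm)).nnnorm.coe_nnreal_ennreal.pow_const _
  rw [lintegral_pairWeight_mul hℓ hij hw hppm (fun X y => by rw [nbodyP_update]),
    lintegral_weight_mul hℓ j (Measurable.lintegral_prod_left hw) hppm
      (fun X y => by rw [nbodyP_nbodyP_update_right ℓ u hij])]
  ring

/-- `∫_Λ∫_Λ w₂(y,x) dy dx = ∬ w₂ = ℓ³(8πa + ∫gω)` (support and (2.10)). [cite: Fournais2020, (2.10)] -/
theorem setLIntegral_setLIntegral_pairLoc₂ (hω : IsScatteringSolution v ω) (hχ : IsLocalizationFunction χ)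
    (hvm : Measurable v) {R D : ℝ} (hR : ∀ r, R < r → v r = 0) (hℓ : 0 < ℓ)
    (hD : ∀ y : Space, ‖y‖ ≤ D → 2⁻¹ ≤ selfConv χ y) (hRℓ : R / ℓ ≤ D) (u : Space) :
    ∫⁻ x in slidingBox ℓ u, ∫⁻ y in slidingBox ℓ u,
        pairLoc₁ v ω χ ℓ u y x * ENNReal.ofReal (1 + ω (y - x)) =
      ENNReal.ofReal (ℓ ^ 3) *
        (ENNReal.ofReal (8 * Real.pi) * scatteringLength v + gOmegaIntegral v ω) := by
  rw [← lintegral_lintegral_pairLoc₂ hχ hω hvm hR hℓ hD hRℓ u]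
  have h1 : ∀ x, ∫⁻ y in slidingBox ℓ u, pairLoc₁ v ω χ ℓ u y x * ENNReal.ofReal (1 + ω (y - x)) =
      ∫⁻ y, pairLoc₁ v ω χ ℓ u x y * ENNReal.ofReal (1 + ω (x - y)) := by
    intro x
    rw [setLIntegral_slidingBox_eq (fun y hy => by rw [pairLoc₁_eq_zero_of_not_mem hχ hℓ hy x, zero_mul])]
    exact lintegral_congr fun y => by rw [pairLoc₁_comm hω hχ ℓ u y x, hω.sub_comm y x]
  simp only [h1]
  refine setLIntegral_slidingBox_eq fun x hx => ?_
  simp [pairLoc₁_eq_zero_of_not_mem hχ hℓ hx]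

/-- **The `0Q` pair term** (real form): `∫ w₂(xᵢ,xⱼ)|PᵢPⱼΦ|² = ℓ⁻³(8πa + ∫gω) ‖PᵢPⱼΦ‖²`.
[cite: Fournais2020, (2.21), (2.23), (2.10)] -/
theorem integral_pairLoc₂_nbodyPP (hℓ : 0 < ℓ) (hω : IsScatteringSolution v ω) (hχ : IsLocalizationFunction χ)
    (hvm : Measurable v) (hsL : scatteringLength v ≠ ⊤) {R D : ℝ} (hR : ∀ r, R < r → v r = 0)
    (hD : ∀ y : Space, ‖y‖ ≤ D → 2⁻¹ ≤ selfConv χ y) (hRℓ : R / ℓ ≤ D) (hij : i ≠ j)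
    (hΦm : Measurable Φ) (hpp2 : MemLp (nbodyP ℓ u i (nbodyP ℓ u j Φ)) 2 (volume.restrict (boxConfig (n + 1) ℓ u))) :
    ∫ X in boxConfig (n + 1) ℓ u,
        (pairLoc₁ v ω χ ℓ u (X i) (X j) * ENNReal.ofReal (1 + ω (X i - X j))).toReal *
          ‖nbodyP ℓ u i (nbodyP ℓ u j Φ) X‖ ^ 2 =
      (ℓ ^ 3)⁻¹ * (8 * Real.pi * (scatteringLength v).toReal + (gOmegaIntegral v ω).toReal) *
        ∫ X in boxConfig (n + 1) ℓ u, ‖nbodyP ℓ u i (nbodyP ℓ u j Φ) X‖ ^ 2 := by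
  have hℓ3 : ENNReal.ofReal ℓ ^ 3 ≠ 0 := pow_ne_zero _ (by rwa [Ne, ENNReal.ofReal_eq_zero, not_le])
  have hℓ3' : ENNReal.ofReal ℓ ^ 3 ≠ ⊤ := ENNReal.pow_ne_top ENNReal.ofReal_ne_top
  have hw₂ := measurable_pairLoc₂_uncurry hvm hω.measurable hχ ℓ u
  have hπ : Measurable fun X : Config (n + 1) => (X i, X j) :=
    (measurable_pi_apply i).prodMk (measurable_pi_apply j)
  have hw₂ij : AEMeasurable (fun X : Config (n + 1) =>
      pairLoc₁ v ω χ ℓ u (X i) (X j) * ENNReal.ofReal (1 + ω (X i - X j)))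
      (volume.restrict (boxConfig (n + 1) ℓ u)) := (hw₂.comp hπ).aemeasurable
  have hppm := measurable_nbodyP ℓ u i (measurable_nbodyP ℓ u j hΦm)
  have hgΩ : gOmegaIntegral v ω ≠ ⊤ :=
    ne_top_of_le_ne_top (ENNReal.mul_ne_top ENNReal.ofReal_ne_top hsL) (gOmegaIntegral_le hω)
  -- the `ℝ≥0∞` identity
  have hE : ∫⁻ X in boxConfig (n + 1) ℓ u, pairLoc₁ v ω χ ℓ u (X i) (X j) * ENNReal.ofReal (1 + ω (X i - X j)) *
      (‖nbodyP ℓ u i (nbodyP ℓ u j Φ) X‖₊ : ℝ≥0∞) ^ 2 =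
      (ENNReal.ofReal ℓ ^ 3)⁻¹ * (ENNReal.ofReal (8 * Real.pi) * scatteringLength v + gOmegaIntegral v ω) *
        ∫⁻ X in boxConfig (n + 1) ℓ u, (‖nbodyP ℓ u i (nbodyP ℓ u j Φ) X‖₊ : ℝ≥0∞) ^ 2 := by
    rw [lintegral_pairWeight_nbodyPP hℓ hij (w := fun x y => pairLoc₁ v ω χ ℓ u x y * ENNReal.ofReal (1 + ω (x - y)))
      hw₂ hΦm, setLIntegral_setLIntegral_pairLoc₂ hω hχ hvm hR hℓ hD hRℓ u, ENNReal.ofReal_pow hℓ.le,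
      mul_assoc ((ENNReal.ofReal ℓ ^ 3)⁻¹), ← mul_assoc ((ENNReal.ofReal ℓ ^ 3)⁻¹) (ENNReal.ofReal ℓ ^ 3),
      ENNReal.inv_mul_cancel hℓ3 hℓ3', one_mul]
  have hfin : ∫⁻ X in boxConfig (n + 1) ℓ u, pairLoc₁ v ω χ ℓ u (X i) (X j) * ENNReal.ofReal (1 + ω (X i - X j)) *
      (‖nbodyP ℓ u i (nbodyP ℓ u j Φ) X‖₊ : ℝ≥0∞) ^ 2 ≠ ⊤ := by
    rw [hE]
    exact ENNReal.mul_ne_top (ENNReal.mul_ne_top (ENNReal.inv_ne_top.mpr hℓ3)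
      (ENNReal.add_ne_top.mpr ⟨ENNReal.mul_ne_top ENNReal.ofReal_ne_top hsL, hgΩ⟩))
      (lintegral_ne_top_of_memLp_two hpp2)
  rw [integral_toReal_mul_norm_sq hw₂ij hppm.aestronglyMeasurable hfin, hE,
    integral_norm_sq_eq_toReal hppm.aestronglyMeasurable, ENNReal.toReal_mul, ENNReal.toReal_mul,
    ENNReal.toReal_add (ENNReal.mul_ne_top ENNReal.ofReal_ne_top hsL) hgΩ, ENNReal.toReal_mul,
    ENNReal.toReal_inv, ENNReal.toReal_pow, ENNReal.toReal_ofReal hℓ.le,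
    ENNReal.toReal_ofReal (by positivity)]

/-- **`‖PᵢPⱼΦ‖² ≥ ‖Φ‖² - ‖QⱼΦ‖² - ‖QᵢΦ‖²`** (Pythagoras twice and `‖Qᵢ(PⱼΦ)‖ ≤ ‖QᵢΦ‖`): the
replacement of `n₀(n₀-1)` by `n² - Cn·n₊` in (2.23) → (2.25). [cite: Fournais2020, (2.23), (2.25)] -/
theorem integral_norm_sq_nbodyPP_ge (hℓ : 0 < ℓ) (hij : i ≠ j) (hΦm : Measurable Φ)
    (hΦ2 : MemLp Φ 2 (volume.restrict (boxConfig (n + 1) ℓ u))) :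
    (∫ X in boxConfig (n + 1) ℓ u, ‖Φ X‖ ^ 2) - (∫ X in boxConfig (n + 1) ℓ u, ‖nbodyQ ℓ u j Φ X‖ ^ 2) -
        (∫ X in boxConfig (n + 1) ℓ u, ‖nbodyQ ℓ u i Φ X‖ ^ 2) ≤
      ∫ X in boxConfig (n + 1) ℓ u, ‖nbodyP ℓ u i (nbodyP ℓ u j Φ) X‖ ^ 2 := by
  have hPj := memLp_nbodyP hℓ j hΦm hΦ2
  have hPjm := measurable_nbodyP ℓ u j hΦm
  have h1 := integral_norm_sq_eq_add hℓ j hΦm hΦ2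
  have h2 := integral_norm_sq_eq_add hℓ i hPjm hPj
  have h3 : (∫ X in boxConfig (n + 1) ℓ u, ‖nbodyQ ℓ u i (nbodyP ℓ u j Φ) X‖ ^ 2) ≤
      ∫ X in boxConfig (n + 1) ℓ u, ‖nbodyQ ℓ u i Φ X‖ ^ 2 := by
    rw [integral_norm_sq_eq_toReal (measurable_nbodyQ ℓ u i hPjm).aestronglyMeasurable,
      integral_norm_sq_eq_toReal (measurable_nbodyQ ℓ u i hΦm).aestronglyMeasurable]
    exact ENNReal.toReal_mono (lintegral_ne_top_of_memLp_two (memLp_nbodyQ hℓ i hΦm hΦ2))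
      (lintegral_nbodyQ_nbodyP_sq_le hℓ hij hΦm (integrable_of_memLp_two hΦ2))
  linarith

end ZeroQ

/-! ### The `2Q` error and the `1Q` cross term of a pair -/

section OneTwoQ

variable {i j : Fin (n + 1)} {Φ : Config (n + 1) → ℂ} {K K₁ : ℝ≥0∞}

/-- The one-`Q` part, a.e.: `Φ - PᵢPⱼΦ - QⱼQᵢΦ = Pᵢ(QⱼΦ) + Pⱼ(QᵢΦ)`. [cite: Fournais2020, (2.16), (2.20)] -/
theorem onePart_ae_eq (hℓ : 0 < ℓ) (i j : Fin (n + 1)) (hΦm : Measurable Φ)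
    (hΦ2 : MemLp Φ 2 (volume.restrict (boxConfig (n + 1) ℓ u))) :
    ∀ᵐ X ∂volume.restrict (boxConfig (n + 1) ℓ u),
      Φ X - nbodyP ℓ u i (nbodyP ℓ u j Φ) X - nbodyQ ℓ u j (nbodyQ ℓ u i Φ) X =
        nbodyP ℓ u i (nbodyQ ℓ u j Φ) X + nbodyP ℓ u j (nbodyQ ℓ u i Φ) X := by
  have hΦ1 := integrable_of_memLp_two hΦ2
  have hPj1 := integrable_nbodyP hℓ j hΦm hΦ1
  filter_upwards [nbodyP_sub_ae i hΦ1 hPj1] with X hX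
  rw [nbodyQ_nbodyQ_eq, show nbodyQ ℓ u j Φ = fun Y => Φ Y - nbodyP ℓ u j Φ Y from rfl, hX]
  ring

/-- **The `2Q` error of a pair**: `∫ w₁(xᵢ,xⱼ)|y|² ≤ 2ℓ⁻³K₁(‖QᵢΦ‖² + ‖QⱼΦ‖²)` for the one-`Q`
part `y`, `K₁ = sup_x ∫w₁(y,x)dy` ("immediately controlled in terms of `a`").
[cite: Fournais2020, Lemma 2.3 (2.22) and the remark preceding it] -/
theorem integral_pairLoc₁_onePart_le (hℓ : 0 < ℓ) (hω : IsScatteringSolution v ω)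
    (hχ : IsLocalizationFunction χ) (hvm : Measurable v)
    (hK₁ : ∀ x, ∫⁻ y in slidingBox ℓ u, pairLoc₁ v ω χ ℓ u y x ≤ K₁) (hK₁' : K₁ ≠ ⊤)
    (hK : ∀ x, ∫⁻ y in slidingBox ℓ u, pairLoc v χ ℓ u y x ≤ K) (hK' : K ≠ ⊤)
    (hΦm : Measurable Φ) (hΦ2 : MemLp Φ 2 (volume.restrict (boxConfig (n + 1) ℓ u))) (hij : i ≠ j)
    (hfin : ∫⁻ X in boxConfig (n + 1) ℓ u, pairLoc v χ ℓ u (X i) (X j) * (‖Φ X‖₊ : ℝ≥0∞) ^ 2 ≠ ⊤) :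
    ∫ X in boxConfig (n + 1) ℓ u, (pairLoc₁ v ω χ ℓ u (X i) (X j)).toReal *
        ‖Φ X - nbodyP ℓ u i (nbodyP ℓ u j Φ) X - nbodyQ ℓ u j (nbodyQ ℓ u i Φ) X‖ ^ 2 ≤
      2 * ((ℓ ^ 3)⁻¹ * K₁.toReal) *
        ((∫ X in boxConfig (n + 1) ℓ u, ‖nbodyQ ℓ u i Φ X‖ ^ 2) +
          ∫ X in boxConfig (n + 1) ℓ u, ‖nbodyQ ℓ u j Φ X‖ ^ 2) := by
  have hℓ3 : ENNReal.ofReal ℓ ^ 3 ≠ 0 := pow_ne_zero _ (by rwa [Ne, ENNReal.ofReal_eq_zero, not_le])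
  have hw₁ := measurable_pairLoc₁₂ hvm hω.measurable hχ ℓ u
  have hπ : Measurable fun X : Config (n + 1) => (X i, X j) :=
    (measurable_pi_apply i).prodMk (measurable_pi_apply j)
  have hw₁ij : AEMeasurable (fun X : Config (n + 1) => pairLoc₁ v ω χ ℓ u (X i) (X j))
      (volume.restrict (boxConfig (n + 1) ℓ u)) := (hw₁.comp hπ).aemeasurable
  have hsymm : ∀ x y, pairLoc₁ v ω χ ℓ u x y = pairLoc₁ v ω χ ℓ u y x := fun x y => pairLoc₁_comm hω hχ ℓ u x y
  have hQi := memLp_nbodyQ hℓ i hΦm hΦ2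
  have hQj := memLp_nbodyQ hℓ j hΦm hΦ2
  have hQim := measurable_nbodyQ ℓ u i hΦm
  have hQjm := measurable_nbodyQ ℓ u j hΦm
  have hym : Measurable fun X => Φ X - nbodyP ℓ u i (nbodyP ℓ u j Φ) X - nbodyQ ℓ u j (nbodyQ ℓ u i Φ) X :=
    (hΦm.sub (measurable_nbodyP ℓ u i (measurable_nbodyP ℓ u j hΦm))).sub (measurable_nbodyQ ℓ u j hQim)
  have fy := lintegral_pairLoc_onePart_ne_top hℓ hχ hvm hK hK' hΦm hΦ2 hij hfin
  have mono₁ : ∀ X : Config (n + 1), pairLoc₁ v ω χ ℓ u (X i) (X j) ≤ pairLoc v χ ℓ u (X i) (X j) :=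
    fun X => pairLoc₁_le_pairLoc hω χ ℓ u _ _
  have fy₁ := lintegral_mul_norm_sq_ne_top_mono mono₁ fy
  rw [integral_toReal_mul_norm_sq hw₁ij hym.aestronglyMeasurable fy₁,
    lintegral_mul_norm_sq_congr_ae _ (onePart_ae_eq hℓ i j hΦm hΦ2),
    integral_norm_sq_eq_toReal hQim.aestronglyMeasurable, integral_norm_sq_eq_toReal hQjm.aestronglyMeasurable]
  -- the `ℝ≥0∞` bound
  have hb1 : ∫⁻ X in boxConfig (n + 1) ℓ u, pairLoc₁ v ω χ ℓ u (X i) (X j) *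
      (‖nbodyP ℓ u i (nbodyQ ℓ u j Φ) X‖₊ : ℝ≥0∞) ^ 2 ≤
      (ENNReal.ofReal ℓ ^ 3)⁻¹ * K₁ * ∫⁻ X in boxConfig (n + 1) ℓ u, (‖nbodyQ ℓ u j Φ X‖₊ : ℝ≥0∞) ^ 2 :=
    calc _ ≤ (ENNReal.ofReal ℓ ^ 3)⁻¹ * K₁ *
          ∫⁻ X in boxConfig (n + 1) ℓ u, (‖nbodyP ℓ u i (nbodyQ ℓ u j Φ) X‖₊ : ℝ≥0∞) ^ 2 :=
          lintegral_pairWeight_mul_le hℓ hij hw₁ hK₁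
            ((measurable_nbodyP ℓ u i hQjm).nnnorm.coe_nnreal_ennreal.pow_const _)
            (fun X y => by rw [nbodyP_update])
      _ ≤ _ := mul_le_mul' le_rfl (lintegral_nbodyP_sq_le (u := u) hℓ i hQjm)
  have hb2 : ∫⁻ X in boxConfig (n + 1) ℓ u, pairLoc₁ v ω χ ℓ u (X i) (X j) *
      (‖nbodyP ℓ u j (nbodyQ ℓ u i Φ) X‖₊ : ℝ≥0∞) ^ 2 ≤
      (ENNReal.ofReal ℓ ^ 3)⁻¹ * K₁ * ∫⁻ X in boxConfig (n + 1) ℓ u, (‖nbodyQ ℓ u i Φ X‖₊ : ℝ≥0∞) ^ 2 :=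
    calc _ ≤ (ENNReal.ofReal ℓ ^ 3)⁻¹ * K₁ *
          ∫⁻ X in boxConfig (n + 1) ℓ u, (‖nbodyP ℓ u j (nbodyQ ℓ u i Φ) X‖₊ : ℝ≥0∞) ^ 2 :=
          lintegral_pairWeight_mul_le_right hℓ hij hw₁ hsymm hK₁
            ((measurable_nbodyP ℓ u j hQim).nnnorm.coe_nnreal_ennreal.pow_const _)
            (fun X y => by rw [nbodyP_update])
      _ ≤ _ := mul_le_mul' le_rfl (lintegral_nbodyP_sq_le (u := u) hℓ j hQim)
  have hb := lintegral_mul_norm_sq_add_le hw₁ij (a := fun X => nbodyP ℓ u i (nbodyQ ℓ u j Φ) X)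
    (measurable_nbodyP ℓ u i hQjm).aestronglyMeasurable (fun X => nbodyP ℓ u j (nbodyQ ℓ u i Φ) X)
    (μ := volume.restrict (boxConfig (n + 1) ℓ u))
  have hNi := lintegral_ne_top_of_memLp_two hQi
  have hNj := lintegral_ne_top_of_memLp_two hQj
  have htot : ∫⁻ X in boxConfig (n + 1) ℓ u, pairLoc₁ v ω χ ℓ u (X i) (X j) *
      (‖nbodyP ℓ u i (nbodyQ ℓ u j Φ) X + nbodyP ℓ u j (nbodyQ ℓ u i Φ) X‖₊ : ℝ≥0∞) ^ 2 ≤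
      2 * ((ENNReal.ofReal ℓ ^ 3)⁻¹ * K₁) *
        ((∫⁻ X in boxConfig (n + 1) ℓ u, (‖nbodyQ ℓ u i Φ X‖₊ : ℝ≥0∞) ^ 2) +
          ∫⁻ X in boxConfig (n + 1) ℓ u, (‖nbodyQ ℓ u j Φ X‖₊ : ℝ≥0∞) ^ 2) := by
    calc _ ≤ _ := hb
      _ ≤ 2 * ((ENNReal.ofReal ℓ ^ 3)⁻¹ * K₁ * ∫⁻ X in boxConfig (n + 1) ℓ u, (‖nbodyQ ℓ u j Φ X‖₊ : ℝ≥0∞) ^ 2) +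
          2 * ((ENNReal.ofReal ℓ ^ 3)⁻¹ * K₁ * ∫⁻ X in boxConfig (n + 1) ℓ u, (‖nbodyQ ℓ u i Φ X‖₊ : ℝ≥0∞) ^ 2) := by
          gcongr
      _ = _ := by ring
  have hfinR : 2 * ((ENNReal.ofReal ℓ ^ 3)⁻¹ * K₁) *
      ((∫⁻ X in boxConfig (n + 1) ℓ u, (‖nbodyQ ℓ u i Φ X‖₊ : ℝ≥0∞) ^ 2) +
        ∫⁻ X in boxConfig (n + 1) ℓ u, (‖nbodyQ ℓ u j Φ X‖₊ : ℝ≥0∞) ^ 2) ≠ ⊤ :=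
    ENNReal.mul_ne_top (ENNReal.mul_ne_top ENNReal.ofNat_ne_top
      (ENNReal.mul_ne_top (ENNReal.inv_ne_top.mpr hℓ3) hK₁')) (ENNReal.add_ne_top.mpr ⟨hNi, hNj⟩)
  have h := ENNReal.toReal_mono hfinR htot
  rw [ENNReal.toReal_mul, ENNReal.toReal_mul, ENNReal.toReal_mul, ENNReal.toReal_add hNi hNj,
    ENNReal.toReal_inv, ENNReal.toReal_pow, ENNReal.toReal_ofReal hℓ.le, ENNReal.toReal_ofNat] at h
  exact h

/-- **The `1Q` cross term of a pair, integrated out**: with `pp = PᵢPⱼΦ` and the one-`Q` part `y`,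
`∫ w₁(xᵢ,xⱼ)Re(conj(pp)y) = ℓ⁻³∫U(xⱼ)Re(conj(pp)QⱼΦ) + ℓ⁻³∫U(xᵢ)Re(conj(pp)QᵢΦ)`,
`U(x) = ∫w₁(x,y)dy` ("`PᵢF(xᵢ,y)Pᵢ = ℓ⁻³Pᵢ∫F(x,y)dx`"). [cite: Fournais2020, remark preceding Lemma 2.3, (2.20), (2.22)] -/
theorem integral_pairLoc₁_cross_eq (hℓ : 0 < ℓ) (hω : IsScatteringSolution v ω)
    (hχ : IsLocalizationFunction χ) (hvm : Measurable v)
    (hK₁ : ∀ x, ∫⁻ y in slidingBox ℓ u, pairLoc₁ v ω χ ℓ u y x ≤ K₁) (hK₁' : K₁ ≠ ⊤)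
    (hΦm : Measurable Φ) (hΦ2 : MemLp Φ 2 (volume.restrict (boxConfig (n + 1) ℓ u))) (hij : i ≠ j) :
    ∫ X in boxConfig (n + 1) ℓ u, (pairLoc₁ v ω χ ℓ u (X i) (X j)).toReal *
        (conj (nbodyP ℓ u i (nbodyP ℓ u j Φ) X) *
          (Φ X - nbodyP ℓ u i (nbodyP ℓ u j Φ) X - nbodyQ ℓ u j (nbodyQ ℓ u i Φ) X)).re =
      ((ℓ ^ 3)⁻¹ * ∫ X in boxConfig (n + 1) ℓ u, (∫⁻ y, pairLoc₁ v ω χ ℓ u (X j) y).toReal *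
          (conj (nbodyP ℓ u i (nbodyP ℓ u j Φ) X) * nbodyQ ℓ u j Φ X).re) +
        ((ℓ ^ 3)⁻¹ * ∫ X in boxConfig (n + 1) ℓ u, (∫⁻ y, pairLoc₁ v ω χ ℓ u (X i) y).toReal *
          (conj (nbodyP ℓ u i (nbodyP ℓ u j Φ) X) * nbodyQ ℓ u i Φ X).re) := by
  have hw₁ := measurable_pairLoc₁₂ hvm hω.measurable hχ ℓ u
  have hsymm : ∀ x y, pairLoc₁ v ω χ ℓ u x y = pairLoc₁ v ω χ ℓ u y x := fun x y => pairLoc₁_comm hω hχ ℓ u x y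
  have hPjm := measurable_nbodyP ℓ u j hΦm
  have hPj := memLp_nbodyP hℓ j hΦm hΦ2
  have hppm := measurable_nbodyP ℓ u i hPjm
  have hpp := memLp_nbodyP hℓ i hPjm hPj
  have hQi := memLp_nbodyQ hℓ i hΦm hΦ2
  have hQj := memLp_nbodyQ hℓ j hΦm hΦ2
  have hQim := measurable_nbodyQ ℓ u i hΦm
  have hQjm := measurable_nbodyQ ℓ u j hΦm
  have hppi : ∀ X y, nbodyP ℓ u i (nbodyP ℓ u j Φ) (Function.update X i y) = nbodyP ℓ u i (nbodyP ℓ u j Φ) X :=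
    fun X y => nbodyP_update ℓ u i _ X y
  have hppj : ∀ X y, nbodyP ℓ u i (nbodyP ℓ u j Φ) (Function.update X j y) = nbodyP ℓ u i (nbodyP ℓ u j Φ) X :=
    fun X y => nbodyP_nbodyP_update_right ℓ u hij Φ X y
  -- split `y` a.e. into `Pᵢ(QⱼΦ) + Pⱼ(QᵢΦ)`
  have Ia := integrable_pairWeight_conj_mul hℓ hij hw₁ hK₁' hK₁ hppm hppi hpp
    (measurable_nbodyP ℓ u i hQjm) (fun X y => nbodyP_update ℓ u i _ X y) (memLp_nbodyP hℓ i hQjm hQj)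
  have Ib' := integrable_pairWeight_conj_mul hℓ hij.symm hw₁ hK₁' hK₁ hppm hppj hpp
    (measurable_nbodyP ℓ u j hQim) (fun X y => nbodyP_update ℓ u j _ X y) (memLp_nbodyP hℓ j hQim hQi)
  have Ib : Integrable (fun X => ((pairLoc₁ v ω χ ℓ u (X i) (X j)).toReal : ℂ) *
      (conj (nbodyP ℓ u i (nbodyP ℓ u j Φ) X) * nbodyP ℓ u j (nbodyQ ℓ u i Φ) X))
      (volume.restrict (boxConfig (n + 1) ℓ u)) :=
    Ib'.congr (Filter.Eventually.of_forall fun X => by simp only [hsymm (X j) (X i)])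
  have hsplit : ∫ X in boxConfig (n + 1) ℓ u, (pairLoc₁ v ω χ ℓ u (X i) (X j)).toReal *
      (conj (nbodyP ℓ u i (nbodyP ℓ u j Φ) X) *
        (Φ X - nbodyP ℓ u i (nbodyP ℓ u j Φ) X - nbodyQ ℓ u j (nbodyQ ℓ u i Φ) X)).re =
      (∫ X in boxConfig (n + 1) ℓ u, (pairLoc₁ v ω χ ℓ u (X i) (X j)).toReal *
        (conj (nbodyP ℓ u i (nbodyP ℓ u j Φ) X) * nbodyP ℓ u i (nbodyQ ℓ u j Φ) X).re) +
      ∫ X in boxConfig (n + 1) ℓ u, (pairLoc₁ v ω χ ℓ u (X i) (X j)).toReal *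
        (conj (nbodyP ℓ u i (nbodyP ℓ u j Φ) X) * nbodyP ℓ u j (nbodyQ ℓ u i Φ) X).re := by
    have hIa := Ia.re
    have hIb := Ib.re
    simp only [RCLike.re_to_complex, Complex.re_ofReal_mul] at hIa hIb
    rw [← integral_add hIa hIb]
    refine integral_congr_ae ?_
    filter_upwards [onePart_ae_eq hℓ i j hΦm hΦ2] with X hX
    rw [hX, mul_add, Complex.add_re, mul_add]
  rw [hsplit, integral_pairWeight_re_conj_mul_nbodyP hℓ hij hw₁ hK₁' hK₁ hppm hppi hpp hQjm hQj]
  -- second term: symmetric weight, roles of `i` and `j` exchanged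
  have h2 : ∫ X in boxConfig (n + 1) ℓ u, (pairLoc₁ v ω χ ℓ u (X i) (X j)).toReal *
      (conj (nbodyP ℓ u i (nbodyP ℓ u j Φ) X) * nbodyP ℓ u j (nbodyQ ℓ u i Φ) X).re =
      ∫ X in boxConfig (n + 1) ℓ u, (pairLoc₁ v ω χ ℓ u (X j) (X i)).toReal *
      (conj (nbodyP ℓ u i (nbodyP ℓ u j Φ) X) * nbodyP ℓ u j (nbodyQ ℓ u i Φ) X).re :=
    integral_congr_ae (Filter.Eventually.of_forall fun X => by simp only [hsymm (X i) (X j)])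
  rw [h2, integral_pairWeight_re_conj_mul_nbodyP hℓ hij.symm hw₁ hK₁' hK₁ hppm hppj hpp hQim hQi]
  simp only [setLIntegral_pairLoc₁_swap hω hχ hℓ]

end OneTwoQ

/-! ### Summing the cross terms over ordered pairs; the attraction -/

section CrossSum

variable {Φ : Config (n + 1) → ℂ} {K₁ : ℝ≥0∞}

/-- The one-body potential `U(x) = ∫w₁(x,y)dy` is measurable. [cite: Fournais2020, (2.6)] -/
theorem measurable_lintegral_pairLoc₁ (hω : IsScatteringSolution v ω) (hχ : IsLocalizationFunction χ)
    (hvm : Measurable v) (ℓ : ℝ) (u : Space) :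
    Measurable fun x : Space => ∫⁻ y, pairLoc₁ v ω χ ℓ u x y :=
  (measurable_pairLoc₁₂ hvm hω.measurable hχ ℓ u).lintegral_prod_right'

/-- `U ≤ K₁` in the form `∫w₁(x,y)dy ≤ K₁` from the marginal bound (support and symmetry).
[cite: Fournais2020, (2.6), (2.8)] -/
theorem lintegral_pairLoc₁_le_of_kbound (hω : IsScatteringSolution v ω) (hχ : IsLocalizationFunction χ)
    (hℓ : 0 < ℓ) (hK₁ : ∀ x, ∫⁻ y in slidingBox ℓ u, pairLoc₁ v ω χ ℓ u y x ≤ K₁) (x : Space) :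
    ∫⁻ y, pairLoc₁ v ω χ ℓ u x y ≤ K₁ := by
  rw [← setLIntegral_pairLoc₁_swap hω hχ hℓ u x]
  exact hK₁ x

/-- **The two families of cross terms coincide after relabelling** (`PⱼPᵢΦ = PᵢPⱼΦ` a.e.):
`∑ᵢ∑_{j≠i} ∫U(xᵢ)Re(conj(PᵢPⱼΦ)QᵢΦ) = ∑ᵢ∑_{j≠i} ∫U(xⱼ)Re(conj(PᵢPⱼΦ)QⱼΦ)`.
[cite: Fournais2020, (2.20), (2.22)] -/
theorem sum_cross_comm (hΦm : Measurable Φ)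
    (hΦ2 : MemLp Φ 2 (volume.restrict (boxConfig (n + 1) ℓ u))) (U : Space → ℝ) :
    ∑ i : Fin (n + 1), ∑ j : Fin (n + 1) with j ≠ i,
        ∫ X in boxConfig (n + 1) ℓ u, U (X i) * (conj (nbodyP ℓ u i (nbodyP ℓ u j Φ) X) * nbodyQ ℓ u i Φ X).re =
      ∑ i : Fin (n + 1), ∑ j : Fin (n + 1) with j ≠ i,
        ∫ X in boxConfig (n + 1) ℓ u, U (X j) * (conj (nbodyP ℓ u i (nbodyP ℓ u j Φ) X) * nbodyQ ℓ u j Φ X).re := by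
  rw [sum_sum_filter_ne_comm]
  refine Finset.sum_congr rfl fun i _ => Finset.sum_congr rfl fun j hj => ?_
  have hji : j ≠ i := (Finset.mem_filter.mp hj).2
  refine integral_congr_ae ?_
  filter_upwards [nbodyP_comm_ae (ℓ := ℓ) (u := u) hji hΦm (integrable_of_memLp_two hΦ2)] with X hX
  rw [hX]

/-- **The attraction, split by `Φ = PₖΦ + QₖΦ` in the attracted particle**:
`∫U(xₖ)|Φ|² = 8πa‖PₖΦ‖² + ∫U(xₖ)|QₖΦ|² + 2∫U(xₖ)Re(conj(PₖΦ)QₖΦ)` (`∫_Λ U = ∬w₁ = 8πaℓ³` and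
`PₖΦ` does not see `xₖ`). [cite: Fournais2020, (2.19)–(2.21), (2.10)] -/
theorem integral_attr_split (hℓ : 0 < ℓ) (hω : IsScatteringSolution v ω) (hχ : IsLocalizationFunction χ)
    (hvm : Measurable v) (hsL : scatteringLength v ≠ ⊤) {R D : ℝ} (hR : ∀ r, R < r → v r = 0)
    (hD : ∀ y : Space, ‖y‖ ≤ D → 2⁻¹ ≤ selfConv χ y) (hRℓ : R / ℓ ≤ D)
    (hK₁ : ∀ x, ∫⁻ y in slidingBox ℓ u, pairLoc₁ v ω χ ℓ u y x ≤ K₁) (hK₁' : K₁ ≠ ⊤)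
    (hΦm : Measurable Φ) (hΦ2 : MemLp Φ 2 (volume.restrict (boxConfig (n + 1) ℓ u))) (k : Fin (n + 1)) :
    ∫ X in boxConfig (n + 1) ℓ u, (∫⁻ y, pairLoc₁ v ω χ ℓ u (X k) y).toReal * ‖Φ X‖ ^ 2 =
      8 * Real.pi * (scatteringLength v).toReal * (∫ X in boxConfig (n + 1) ℓ u, ‖nbodyP ℓ u k Φ X‖ ^ 2) +
        (∫ X in boxConfig (n + 1) ℓ u, (∫⁻ y, pairLoc₁ v ω χ ℓ u (X k) y).toReal * ‖nbodyQ ℓ u k Φ X‖ ^ 2) +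
        2 * ∫ X in boxConfig (n + 1) ℓ u, (∫⁻ y, pairLoc₁ v ω χ ℓ u (X k) y).toReal *
          (conj (nbodyP ℓ u k Φ X) * nbodyQ ℓ u k Φ X).re := by
  have hℓ3 : ENNReal.ofReal ℓ ^ 3 ≠ 0 := pow_ne_zero _ (by rwa [Ne, ENNReal.ofReal_eq_zero, not_le])
  have hℓ3' : ENNReal.ofReal ℓ ^ 3 ≠ ⊤ := ENNReal.pow_ne_top ENNReal.ofReal_ne_top
  have hUm := measurable_lintegral_pairLoc₁ hω hχ hvm ℓ u
  have hUk : Measurable fun X : Config (n + 1) => ∫⁻ y, pairLoc₁ v ω χ ℓ u (X k) y :=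
    hUm.comp (measurable_pi_apply k)
  have hUb : ∀ x, ∫⁻ y, pairLoc₁ v ω χ ℓ u x y ≤ K₁ := lintegral_pairLoc₁_le_of_kbound hω hχ hℓ hK₁
  have hUr : ∀ X : Config (n + 1), ‖((∫⁻ y, pairLoc₁ v ω χ ℓ u (X k) y).toReal : ℝ)‖ ≤ K₁.toReal := fun X => by
    rw [Real.norm_of_nonneg ENNReal.toReal_nonneg]
    exact ENNReal.toReal_mono hK₁' (hUb _)
  have hP := memLp_nbodyP hℓ k hΦm hΦ2
  have hQ := memLp_nbodyQ hℓ k hΦm hΦ2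
  have hPm := measurable_nbodyP ℓ u k hΦm
  have hQm := measurable_nbodyQ ℓ u k hΦm
  -- integrability (bounded weight)
  have hUas : AEStronglyMeasurable (fun X : Config (n + 1) => (∫⁻ y, pairLoc₁ v ω χ ℓ u (X k) y).toReal)
      (volume.restrict (boxConfig (n + 1) ℓ u)) := hUk.ennreal_toReal.aestronglyMeasurable
  have IP : Integrable (fun X => (∫⁻ y, pairLoc₁ v ω χ ℓ u (X k) y).toReal * ‖nbodyP ℓ u k Φ X‖ ^ 2)
      (volume.restrict (boxConfig (n + 1) ℓ u)) :=
    (hP.integrable_norm_pow two_ne_zero).bdd_mul hUas (Filter.Eventually.of_forall hUr)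
  have IQ : Integrable (fun X => (∫⁻ y, pairLoc₁ v ω χ ℓ u (X k) y).toReal * ‖nbodyQ ℓ u k Φ X‖ ^ 2)
      (volume.restrict (boxConfig (n + 1) ℓ u)) :=
    (hQ.integrable_norm_pow two_ne_zero).bdd_mul hUas (Filter.Eventually.of_forall hUr)
  have IPQ : Integrable (fun X => (∫⁻ y, pairLoc₁ v ω χ ℓ u (X k) y).toReal *
      (conj (nbodyP ℓ u k Φ X) * nbodyQ ℓ u k Φ X).re) (volume.restrict (boxConfig (n + 1) ℓ u)) :=
    (integrable_conj_mul hP hQ).re.bdd_mul hUas (Filter.Eventually.of_forall hUr)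
  -- pointwise splitting
  have hpt : ∀ X, (∫⁻ y, pairLoc₁ v ω χ ℓ u (X k) y).toReal * ‖Φ X‖ ^ 2 =
      (∫⁻ y, pairLoc₁ v ω χ ℓ u (X k) y).toReal * ‖nbodyP ℓ u k Φ X‖ ^ 2 +
        (∫⁻ y, pairLoc₁ v ω χ ℓ u (X k) y).toReal * ‖nbodyQ ℓ u k Φ X‖ ^ 2 +
        2 * ((∫⁻ y, pairLoc₁ v ω χ ℓ u (X k) y).toReal * (conj (nbodyP ℓ u k Φ X) * nbodyQ ℓ u k Φ X).re) := by
    intro X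
    have hΦX : Φ X = nbodyP ℓ u k Φ X + nbodyQ ℓ u k Φ X := by rw [nbodyQ, add_sub_cancel]
    conv_lhs => rw [hΦX, norm_add_sq_complex]
    ring
  simp only [hpt]
  rw [integral_add (f := fun X => (∫⁻ y, pairLoc₁ v ω χ ℓ u (X k) y).toReal * ‖nbodyP ℓ u k Φ X‖ ^ 2 +
        (∫⁻ y, pairLoc₁ v ω χ ℓ u (X k) y).toReal * ‖nbodyQ ℓ u k Φ X‖ ^ 2)
      (g := fun X => 2 * ((∫⁻ y, pairLoc₁ v ω χ ℓ u (X k) y).toReal *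
        (conj (nbodyP ℓ u k Φ X) * nbodyQ ℓ u k Φ X).re)) (IP.add IQ) (IPQ.const_mul 2),
    integral_add IP IQ, integral_const_mul]
  congr 2
  -- `∫ U(xₖ)|PₖΦ|² = 8πa ‖PₖΦ‖²`
  have hG : Measurable fun X : Config (n + 1) => (‖nbodyP ℓ u k Φ X‖₊ : ℝ≥0∞) ^ 2 :=
    hPm.nnnorm.coe_nnreal_ennreal.pow_const _
  have hE : ∫⁻ X in boxConfig (n + 1) ℓ u, (∫⁻ y, pairLoc₁ v ω χ ℓ u (X k) y) *
      (‖nbodyP ℓ u k Φ X‖₊ : ℝ≥0∞) ^ 2 =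
      ENNReal.ofReal (8 * Real.pi) * scatteringLength v *
        ∫⁻ X in boxConfig (n + 1) ℓ u, (‖nbodyP ℓ u k Φ X‖₊ : ℝ≥0∞) ^ 2 := by
    rw [lintegral_weight_mul hℓ k hUm hG (fun X y => by rw [nbodyP_update]),
      setLIntegral_slidingBox_eq (fun x hx => ?_), lintegral_lintegral_pairLoc₁ hχ hω hvm hR hℓ hD hRℓ u,
      ENNReal.ofReal_pow hℓ.le, ← mul_assoc, ← mul_assoc, ENNReal.inv_mul_cancel hℓ3 hℓ3', one_mul]
    simp [pairLoc₁, locFun_eq_zero_of_not_mem hχ hℓ hx]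
  have hfin : ∫⁻ X in boxConfig (n + 1) ℓ u, (∫⁻ y, pairLoc₁ v ω χ ℓ u (X k) y) *
      (‖nbodyP ℓ u k Φ X‖₊ : ℝ≥0∞) ^ 2 ≠ ⊤ := by
    rw [hE]
    exact ENNReal.mul_ne_top (ENNReal.mul_ne_top ENNReal.ofReal_ne_top hsL) (lintegral_ne_top_of_memLp_two hP)
  rw [integral_toReal_mul_norm_sq hUk.aemeasurable hPm.aestronglyMeasurable hfin, hE,
    integral_norm_sq_eq_toReal hPm.aestronglyMeasurable, ENNReal.toReal_mul, ENNReal.toReal_mul,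
    ENNReal.toReal_ofReal (by positivity)]

/-- `∫U(xₖ)|G|² ≤ K₁‖G‖²` for the bounded one-body potential. [cite: Fournais2020, (2.6)] -/
theorem integral_attr_mul_norm_sq_le (hω : IsScatteringSolution v ω) (hχ : IsLocalizationFunction χ)
    (hℓ : 0 < ℓ)
    (hK₁ : ∀ x, ∫⁻ y in slidingBox ℓ u, pairLoc₁ v ω χ ℓ u y x ≤ K₁) (hK₁' : K₁ ≠ ⊤)
    {G : Config (n + 1) → ℂ} (hG2 : MemLp G 2 (volume.restrict (boxConfig (n + 1) ℓ u))) (k : Fin (n + 1)) :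
    ∫ X in boxConfig (n + 1) ℓ u, (∫⁻ y, pairLoc₁ v ω χ ℓ u (X k) y).toReal * ‖G X‖ ^ 2 ≤
      K₁.toReal * ∫ X in boxConfig (n + 1) ℓ u, ‖G X‖ ^ 2 := by
  have hUb : ∀ x, ∫⁻ y, pairLoc₁ v ω χ ℓ u x y ≤ K₁ := lintegral_pairLoc₁_le_of_kbound hω hχ hℓ hK₁
  rw [← integral_const_mul]
  refine integral_mono_of_nonneg (Filter.Eventually.of_forall fun X => by positivity)
    ((hG2.integrable_norm_pow two_ne_zero).const_mul _) (Filter.Eventually.of_forall fun X => ?_)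
  exact mul_le_mul_of_nonneg_right (ENNReal.toReal_mono hK₁' (hUb _)) (by positivity)

end CrossSum

/-! ### The completed square in the one-`Q` terms: `A_j = ℓ⁻³∑_{i≠j}PᵢPⱼΦ - ρ_μPⱼΦ` -/

section OneQ

variable {Φ : Config (n + 1) → ℂ} {K₁ : ℝ≥0∞}

/-- **`∫U(xₖ)|G|² = 8πa‖G‖²` for `G` not depending on `xₖ`** (`∫_Λ U = ∬w₁ = 8πaℓ³` (2.10)).
[cite: Fournais2020, (2.10), (2.21)] -/
theorem integral_attr_mul_norm_sq_eq (hℓ : 0 < ℓ) (hω : IsScatteringSolution v ω) (hχ : IsLocalizationFunction χ)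
    (hvm : Measurable v) (hsL : scatteringLength v ≠ ⊤) {R D : ℝ} (hR : ∀ r, R < r → v r = 0)
    (hD : ∀ y : Space, ‖y‖ ≤ D → 2⁻¹ ≤ selfConv χ y) (hRℓ : R / ℓ ≤ D) (k : Fin (n + 1))
    {G : Config (n + 1) → ℂ} (hGm : Measurable G) (hG : ∀ X y, G (Function.update X k y) = G X)
    (hG2 : MemLp G 2 (volume.restrict (boxConfig (n + 1) ℓ u))) :
    ∫ X in boxConfig (n + 1) ℓ u, (∫⁻ y, pairLoc₁ v ω χ ℓ u (X k) y).toReal * ‖G X‖ ^ 2 =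
      8 * Real.pi * (scatteringLength v).toReal * ∫ X in boxConfig (n + 1) ℓ u, ‖G X‖ ^ 2 := by
  have hℓ3 : ENNReal.ofReal ℓ ^ 3 ≠ 0 := pow_ne_zero _ (by rwa [Ne, ENNReal.ofReal_eq_zero, not_le])
  have hℓ3' : ENNReal.ofReal ℓ ^ 3 ≠ ⊤ := ENNReal.pow_ne_top ENNReal.ofReal_ne_top
  have hUm := measurable_lintegral_pairLoc₁ hω hχ hvm ℓ u
  have hUk : Measurable fun X : Config (n + 1) => ∫⁻ y, pairLoc₁ v ω χ ℓ u (X k) y :=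
    hUm.comp (measurable_pi_apply k)
  have hGn : Measurable fun X : Config (n + 1) => (‖G X‖₊ : ℝ≥0∞) ^ 2 :=
    hGm.nnnorm.coe_nnreal_ennreal.pow_const _
  have hE : ∫⁻ X in boxConfig (n + 1) ℓ u, (∫⁻ y, pairLoc₁ v ω χ ℓ u (X k) y) * (‖G X‖₊ : ℝ≥0∞) ^ 2 =
      ENNReal.ofReal (8 * Real.pi) * scatteringLength v *
        ∫⁻ X in boxConfig (n + 1) ℓ u, (‖G X‖₊ : ℝ≥0∞) ^ 2 := by
    rw [lintegral_weight_mul hℓ k hUm hGn (fun X y => by rw [hG]),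
      setLIntegral_slidingBox_eq (fun x hx => ?_), lintegral_lintegral_pairLoc₁ hχ hω hvm hR hℓ hD hRℓ u,
      ENNReal.ofReal_pow hℓ.le, ← mul_assoc, ← mul_assoc, ENNReal.inv_mul_cancel hℓ3 hℓ3', one_mul]
    simp [pairLoc₁, locFun_eq_zero_of_not_mem hχ hℓ hx]
  have hfin : ∫⁻ X in boxConfig (n + 1) ℓ u, (∫⁻ y, pairLoc₁ v ω χ ℓ u (X k) y) *
      (‖G X‖₊ : ℝ≥0∞) ^ 2 ≠ ⊤ := by
    rw [hE]
    exact ENNReal.mul_ne_top (ENNReal.mul_ne_top ENNReal.ofReal_ne_top hsL) (lintegral_ne_top_of_memLp_two hG2)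
  rw [integral_toReal_mul_norm_sq hUk.aemeasurable hGm.aestronglyMeasurable hfin, hE,
    integral_norm_sq_eq_toReal hGm.aestronglyMeasurable, ENNReal.toReal_mul, ENNReal.toReal_mul,
    ENNReal.toReal_ofReal (by positivity)]

/-- **Cauchy–Schwarz on the one-`Q` terms, integrated**: for a bounded weight `0 ≤ U ≤ c` and
`A, B ∈ L²`, `2∫U Re(conj(A)B) ≥ -λ∫U|A|² - λ⁻¹∫U|B|²`. [cite: Fournais2020, proof of Lemma 2.3] -/
theorem integral_cs_oneQ {U : Config (n + 1) → ℝ} (hUm : Measurable U) (hU0 : ∀ X, 0 ≤ U X) {c : ℝ}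
    (hUc : ∀ X, U X ≤ c) {A B : Config (n + 1) → ℂ}
    (hA2 : MemLp A 2 (volume.restrict (boxConfig (n + 1) ℓ u)))
    (hB2 : MemLp B 2 (volume.restrict (boxConfig (n + 1) ℓ u))) {lam : ℝ} (hlam : 0 < lam) :
    -(lam * ∫ X in boxConfig (n + 1) ℓ u, U X * ‖A X‖ ^ 2) -
        lam⁻¹ * (∫ X in boxConfig (n + 1) ℓ u, U X * ‖B X‖ ^ 2) ≤
      2 * ∫ X in boxConfig (n + 1) ℓ u, U X * (conj (A X) * B X).re := by
  have hUr : ∀ X, ‖U X‖ ≤ c := fun X => by rw [Real.norm_of_nonneg (hU0 X)]; exact hUc X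
  have hUas : AEStronglyMeasurable U (volume.restrict (boxConfig (n + 1) ℓ u)) := hUm.aestronglyMeasurable
  have IA : Integrable (fun X => U X * ‖A X‖ ^ 2) (volume.restrict (boxConfig (n + 1) ℓ u)) :=
    (hA2.integrable_norm_pow two_ne_zero).bdd_mul hUas (Filter.Eventually.of_forall hUr)
  have IB : Integrable (fun X => U X * ‖B X‖ ^ 2) (volume.restrict (boxConfig (n + 1) ℓ u)) :=
    (hB2.integrable_norm_pow two_ne_zero).bdd_mul hUas (Filter.Eventually.of_forall hUr)
  have IAB : Integrable (fun X => U X * (conj (A X) * B X).re) (volume.restrict (boxConfig (n + 1) ℓ u)) :=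
    (integrable_conj_mul hA2 hB2).re.bdd_mul hUas (Filter.Eventually.of_forall hUr)
  have h1 : ∫ X in boxConfig (n + 1) ℓ u, (-(lam * (U X * ‖A X‖ ^ 2)) - lam⁻¹ * (U X * ‖B X‖ ^ 2)) =
      -(lam * ∫ X in boxConfig (n + 1) ℓ u, U X * ‖A X‖ ^ 2) -
        lam⁻¹ * (∫ X in boxConfig (n + 1) ℓ u, U X * ‖B X‖ ^ 2) := by
    rw [integral_sub (f := fun X => -(lam * (U X * ‖A X‖ ^ 2))) (g := fun X => lam⁻¹ * (U X * ‖B X‖ ^ 2))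
      ((IA.const_mul lam).neg) (IB.const_mul lam⁻¹), integral_neg, integral_const_mul, integral_const_mul]
  have h2 : ∫ X in boxConfig (n + 1) ℓ u, 2 * (U X * (conj (A X) * B X).re) =
      2 * ∫ X in boxConfig (n + 1) ℓ u, U X * (conj (A X) * B X).re := integral_const_mul _ _
  have hmono : ∫ X in boxConfig (n + 1) ℓ u, (-(lam * (U X * ‖A X‖ ^ 2)) - lam⁻¹ * (U X * ‖B X‖ ^ 2)) ≤
      ∫ X in boxConfig (n + 1) ℓ u, 2 * (U X * (conj (A X) * B X).re) :=
    integral_mono (((IA.const_mul lam).neg).sub (IB.const_mul lam⁻¹)) (IAB.const_mul 2) fun X =>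
      two_mul_re_ge (A X) (B X) (hU0 X) hlam
  linarith

/-- **Collecting the one-`Q` terms of particle `j`**: with `A_j = ℓ⁻³∑_{i≠j}PᵢPⱼΦ - ρ_μPⱼΦ`,
`ℓ⁻³∑_{i≠j}∫U(xⱼ)Re(conj(PᵢPⱼΦ)QⱼΦ) - ρ_μ∫U(xⱼ)Re(conj(PⱼΦ)QⱼΦ) = ∫U(xⱼ)Re(conj(A_j)QⱼΦ)`.
[cite: Fournais2020, (2.19)–(2.20), (2.22)] -/
theorem integral_oneQ_collect {U : Config (n + 1) → ℝ} (hUm : Measurable U) {c : ℝ} (hUc : ∀ X, ‖U X‖ ≤ c)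
    (hℓ : 0 < ℓ) (hΦm : Measurable Φ) (hΦ2 : MemLp Φ 2 (volume.restrict (boxConfig (n + 1) ℓ u)))
    (ρμ : ℝ) (j : Fin (n + 1)) :
    ∫ X in boxConfig (n + 1) ℓ u, U X *
        (conj ((((ℓ ^ 3)⁻¹ : ℝ) : ℂ) * (∑ i : Fin (n + 1) with i ≠ j, nbodyP ℓ u i (nbodyP ℓ u j Φ) X) -
            (ρμ : ℂ) * nbodyP ℓ u j Φ X) * nbodyQ ℓ u j Φ X).re =
      (ℓ ^ 3)⁻¹ * (∑ i : Fin (n + 1) with i ≠ j,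
          ∫ X in boxConfig (n + 1) ℓ u, U X * (conj (nbodyP ℓ u i (nbodyP ℓ u j Φ) X) * nbodyQ ℓ u j Φ X).re) -
        ρμ * ∫ X in boxConfig (n + 1) ℓ u, U X * (conj (nbodyP ℓ u j Φ X) * nbodyQ ℓ u j Φ X).re := by
  have hUas : AEStronglyMeasurable U (volume.restrict (boxConfig (n + 1) ℓ u)) := hUm.aestronglyMeasurable
  have hPjm := measurable_nbodyP ℓ u j hΦm
  have hPj := memLp_nbodyP hℓ j hΦm hΦ2
  have hQj := memLp_nbodyQ hℓ j hΦm hΦ2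
  have hpp : ∀ i, MemLp (nbodyP ℓ u i (nbodyP ℓ u j Φ)) 2 (volume.restrict (boxConfig (n + 1) ℓ u)) :=
    fun i => memLp_nbodyP hℓ i hPjm hPj
  have Ii : ∀ i, Integrable (fun X => U X * (conj (nbodyP ℓ u i (nbodyP ℓ u j Φ) X) * nbodyQ ℓ u j Φ X).re)
      (volume.restrict (boxConfig (n + 1) ℓ u)) :=
    fun i => (integrable_conj_mul (hpp i) hQj).re.bdd_mul hUas (Filter.Eventually.of_forall hUc)
  have IP : Integrable (fun X => U X * (conj (nbodyP ℓ u j Φ X) * nbodyQ ℓ u j Φ X).re)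
      (volume.restrict (boxConfig (n + 1) ℓ u)) :=
    (integrable_conj_mul hPj hQj).re.bdd_mul hUas (Filter.Eventually.of_forall hUc)
  have hpt : ∀ X, U X * (conj ((((ℓ ^ 3)⁻¹ : ℝ) : ℂ) *
      (∑ i : Fin (n + 1) with i ≠ j, nbodyP ℓ u i (nbodyP ℓ u j Φ) X) - (ρμ : ℂ) * nbodyP ℓ u j Φ X) *
        nbodyQ ℓ u j Φ X).re =
      (ℓ ^ 3)⁻¹ * (∑ i : Fin (n + 1) with i ≠ j,
          U X * (conj (nbodyP ℓ u i (nbodyP ℓ u j Φ) X) * nbodyQ ℓ u j Φ X).re) -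
        ρμ * (U X * (conj (nbodyP ℓ u j Φ X) * nbodyQ ℓ u j Φ X).re) := by
    intro X
    have hre : (conj ((((ℓ ^ 3)⁻¹ : ℝ) : ℂ) *
        (∑ i : Fin (n + 1) with i ≠ j, nbodyP ℓ u i (nbodyP ℓ u j Φ) X) - (ρμ : ℂ) * nbodyP ℓ u j Φ X) *
          nbodyQ ℓ u j Φ X).re =
        (ℓ ^ 3)⁻¹ * (∑ i : Fin (n + 1) with i ≠ j, (conj (nbodyP ℓ u i (nbodyP ℓ u j Φ) X) * nbodyQ ℓ u j Φ X).re) -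
          ρμ * (conj (nbodyP ℓ u j Φ X) * nbodyQ ℓ u j Φ X).re := by
      simp only [map_sub, map_mul, Complex.conj_ofReal, map_sum, sub_mul, Finset.sum_mul, Complex.sub_re,
        mul_assoc, Complex.re_ofReal_mul, Complex.re_sum]
    rw [hre, mul_sub, ← mul_assoc, mul_comm (U X) ((ℓ ^ 3)⁻¹), mul_assoc, Finset.mul_sum]
    ring
  simp only [hpt]
  rw [integral_sub ((integrable_finsetSum _ fun i _ => Ii i).const_mul _) (IP.const_mul _),
    integral_const_mul, integral_const_mul, integral_finsetSum _ fun i _ => Ii i]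

/-- `∑_{i≠j} PᵢPⱼΦ = (m-1)PⱼΦ - ∑_{i≠j}Qᵢ(PⱼΦ)` pointwise, so that
`A_j = αPⱼΦ - ℓ⁻³∑_{i≠j}Qᵢ(PⱼΦ)` with `α = (m-1)ℓ⁻³ - ρ_μ`. [cite: Fournais2020, (2.5), (2.15)] -/
theorem oneQ_A_eq (ℓ : ℝ) (u : Space) (ρμ : ℝ) (j : Fin (n + 1)) (Φ : Config (n + 1) → ℂ) (X : Config (n + 1)) :
    (((ℓ ^ 3)⁻¹ : ℝ) : ℂ) * (∑ i : Fin (n + 1) with i ≠ j, nbodyP ℓ u i (nbodyP ℓ u j Φ) X) -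
        (ρμ : ℂ) * nbodyP ℓ u j Φ X =
      ((((n + 1 : ℕ) - 1 : ℝ) * (ℓ ^ 3)⁻¹ - ρμ : ℝ) : ℂ) * nbodyP ℓ u j Φ X -
        (((ℓ ^ 3)⁻¹ : ℝ) : ℂ) * ∑ i : Fin (n + 1) with i ≠ j, nbodyQ ℓ u i (nbodyP ℓ u j Φ) X := by
  have h1 : ∀ i, nbodyP ℓ u i (nbodyP ℓ u j Φ) X = nbodyP ℓ u j Φ X - nbodyQ ℓ u i (nbodyP ℓ u j Φ) X :=
    fun i => by rw [nbodyQ, sub_sub_cancel]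
  simp only [h1, Finset.sum_sub_distrib, Finset.sum_const, Finset.filter_ne', Finset.card_erase_of_mem
    (Finset.mem_univ j), Finset.card_univ, Fintype.card_fin, nsmul_eq_mul]
  push_cast
  ring

/-- **The norm of `A_j`**: `‖A_j‖² ≤ α²‖PⱼΦ‖² + (2|α|ℓ⁻³ + ℓ⁻⁶(m-1))∑_{i≠j}‖QᵢΦ‖²`
(`Re⟨PⱼΦ, Qᵢ(PⱼΦ)⟩ = ‖Qᵢ(PⱼΦ)‖² ≥ 0`, Cauchy–Schwarz in the finite sum, `‖Qᵢ(PⱼΦ)‖ ≤ ‖QᵢΦ‖`).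
[cite: Fournais2020, (2.22)–(2.23), (2.25)] -/
theorem integral_norm_sq_oneQ_A_le (hℓ : 0 < ℓ) (hΦm : Measurable Φ)
    (hΦ2 : MemLp Φ 2 (volume.restrict (boxConfig (n + 1) ℓ u))) (ρμ : ℝ) (j : Fin (n + 1)) :
    ∫ X in boxConfig (n + 1) ℓ u,
        ‖(((ℓ ^ 3)⁻¹ : ℝ) : ℂ) * (∑ i : Fin (n + 1) with i ≠ j, nbodyP ℓ u i (nbodyP ℓ u j Φ) X) -
          (ρμ : ℂ) * nbodyP ℓ u j Φ X‖ ^ 2 ≤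
      (((n + 1 : ℕ) - 1 : ℝ) * (ℓ ^ 3)⁻¹ - ρμ) ^ 2 * (∫ X in boxConfig (n + 1) ℓ u, ‖nbodyP ℓ u j Φ X‖ ^ 2) +
        (2 * |((n + 1 : ℕ) - 1 : ℝ) * (ℓ ^ 3)⁻¹ - ρμ| * (ℓ ^ 3)⁻¹ + (ℓ ^ 3)⁻¹ ^ 2 * ((n + 1 : ℕ) - 1 : ℝ)) *
          ∑ i : Fin (n + 1) with i ≠ j, ∫ X in boxConfig (n + 1) ℓ u, ‖nbodyQ ℓ u i Φ X‖ ^ 2 := by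
  simp only [oneQ_A_eq]
  set α : ℝ := ((n + 1 : ℕ) - 1 : ℝ) * (ℓ ^ 3)⁻¹ - ρμ with hα
  set β : ℝ := (ℓ ^ 3)⁻¹ with hβ
  set F := nbodyP ℓ u j Φ with hF
  set G : Config (n + 1) → ℂ := fun X => ∑ i : Fin (n + 1) with i ≠ j, nbodyQ ℓ u i F X with hG
  have hβ0 : 0 < β := by positivity
  have hFm : Measurable F := measurable_nbodyP ℓ u j hΦm
  have hF2 : MemLp F 2 (volume.restrict (boxConfig (n + 1) ℓ u)) := memLp_nbodyP hℓ j hΦm hΦ2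
  have hQFm : ∀ i, Measurable (nbodyQ ℓ u i F) := fun i => measurable_nbodyQ ℓ u i hFm
  have hQF2 : ∀ i, MemLp (nbodyQ ℓ u i F) 2 (volume.restrict (boxConfig (n + 1) ℓ u)) :=
    fun i => memLp_nbodyQ hℓ i hFm hF2
  have hGm : Measurable G := Finset.measurable_sum _ fun i _ => hQFm i
  have hG2 : MemLp G 2 (volume.restrict (boxConfig (n + 1) ℓ u)) := memLp_finsetSum _ fun i _ => hQF2 i
  -- `A = αF - βG`
  change ∫ X in boxConfig (n + 1) ℓ u, ‖(α : ℂ) * F X - (β : ℂ) * G X‖ ^ 2 ≤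
    α ^ 2 * (∫ X in boxConfig (n + 1) ℓ u, ‖F X‖ ^ 2) +
      (2 * |α| * β + β ^ 2 * ((n + 1 : ℕ) - 1 : ℝ)) *
        ∑ i : Fin (n + 1) with i ≠ j, ∫ X in boxConfig (n + 1) ℓ u, ‖nbodyQ ℓ u i Φ X‖ ^ 2
  -- expand the square
  have hpt : ∀ X, ‖(α : ℂ) * F X - (β : ℂ) * G X‖ ^ 2 =
      α ^ 2 * ‖F X‖ ^ 2 + β ^ 2 * ‖G X‖ ^ 2 - 2 * (α * β) * (conj (F X) * G X).re := by
    intro X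
    rw [sub_eq_add_neg, norm_add_sq_complex, norm_neg, norm_mul, norm_mul, Complex.norm_real, Complex.norm_real,
      Real.norm_eq_abs, Real.norm_eq_abs, mul_pow, mul_pow, sq_abs, sq_abs, map_mul, Complex.conj_ofReal]
    have : ((α : ℂ) * conj (F X) * -((β : ℂ) * G X)).re = -(α * β * (conj (F X) * G X).re) := by
      rw [show (α : ℂ) * conj (F X) * -((β : ℂ) * G X) = -(((α * β : ℝ) : ℂ) * (conj (F X) * G X)) by
        push_cast; ring, Complex.neg_re, Complex.re_ofReal_mul]
    rw [this]
    ring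
  have IF : Integrable (fun X => ‖F X‖ ^ 2) (volume.restrict (boxConfig (n + 1) ℓ u)) :=
    hF2.integrable_norm_pow two_ne_zero
  have IG : Integrable (fun X => ‖G X‖ ^ 2) (volume.restrict (boxConfig (n + 1) ℓ u)) :=
    hG2.integrable_norm_pow two_ne_zero
  have IFG : Integrable (fun X => (conj (F X) * G X).re) (volume.restrict (boxConfig (n + 1) ℓ u)) :=
    (integrable_conj_mul hF2 hG2).re
  have hexp : ∫ X in boxConfig (n + 1) ℓ u, ‖(α : ℂ) * F X - (β : ℂ) * G X‖ ^ 2 =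
      α ^ 2 * (∫ X in boxConfig (n + 1) ℓ u, ‖F X‖ ^ 2) + β ^ 2 * (∫ X in boxConfig (n + 1) ℓ u, ‖G X‖ ^ 2) -
        2 * (α * β) * ∫ X in boxConfig (n + 1) ℓ u, (conj (F X) * G X).re := by
    simp only [hpt]
    rw [integral_sub (f := fun X => α ^ 2 * ‖F X‖ ^ 2 + β ^ 2 * ‖G X‖ ^ 2)
        (g := fun X => 2 * (α * β) * (conj (F X) * G X).re) ((IF.const_mul _).add (IG.const_mul _))
        (IFG.const_mul _),
      integral_add (f := fun X => α ^ 2 * ‖F X‖ ^ 2) (g := fun X => β ^ 2 * ‖G X‖ ^ 2) (IF.const_mul _)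
        (IG.const_mul _), integral_const_mul, integral_const_mul, integral_const_mul]
  -- `Re⟨F, G⟩ = ∑ ‖QᵢF‖² =: S ≥ 0`
  have hS : ∫ X in boxConfig (n + 1) ℓ u, (conj (F X) * G X).re =
      ∑ i : Fin (n + 1) with i ≠ j, ∫ X in boxConfig (n + 1) ℓ u, ‖nbodyQ ℓ u i F X‖ ^ 2 := by
    have h1 : ∀ X, (conj (F X) * G X).re = ∑ i : Fin (n + 1) with i ≠ j, (conj (F X) * nbodyQ ℓ u i F X).re := by
      intro X
      simp only [hG, Finset.mul_sum, Complex.re_sum]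
    simp only [h1]
    rw [integral_finsetSum (f := fun i X => (conj (F X) * nbodyQ ℓ u i F X).re) _
      fun i _ => (integrable_conj_mul hF2 (hQF2 i)).re]
    refine Finset.sum_congr rfl fun i _ => ?_
    have h := integral_re (integrable_conj_mul hF2 (hQF2 i))
    simp only [RCLike.re_to_complex] at h
    rw [h, integral_conj_mul_nbodyQ_self hℓ i hFm hF2, Complex.ofReal_re]
  -- `‖G‖² ≤ (m-1) S`
  have hGle : ∫ X in boxConfig (n + 1) ℓ u, ‖G X‖ ^ 2 ≤
      ((n + 1 : ℕ) - 1 : ℝ) * ∑ i : Fin (n + 1) with i ≠ j, ∫ X in boxConfig (n + 1) ℓ u, ‖nbodyQ ℓ u i F X‖ ^ 2 := by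
    rw [← integral_finsetSum _ fun i _ => (hQF2 i).integrable_norm_pow two_ne_zero, ← integral_const_mul]
    refine integral_mono IG ((integrable_finsetSum _ fun i _ =>
      (hQF2 i).integrable_norm_pow two_ne_zero).const_mul _) fun X => ?_
    have h := norm_sum_sq_le (Finset.univ.filter fun i => i ≠ j) (fun i => nbodyQ ℓ u i F X)
    rw [Finset.filter_ne', Finset.card_erase_of_mem (Finset.mem_univ j), Finset.card_univ,
      Fintype.card_fin, Nat.add_sub_cancel] at h
    have hn : ((n + 1 : ℕ) - 1 : ℝ) = n := by push_cast; ring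
    show ‖∑ i : Fin (n + 1) with i ≠ j, nbodyQ ℓ u i F X‖ ^ 2 ≤
      ((n + 1 : ℕ) - 1 : ℝ) * ∑ i : Fin (n + 1) with i ≠ j, ‖nbodyQ ℓ u i F X‖ ^ 2
    rw [Finset.filter_ne', hn]
    exact h
  -- `‖QᵢF‖ ≤ ‖QᵢΦ‖`
  have hQle : ∀ i ∈ Finset.univ.filter (fun i => i ≠ j),
      (∫ X in boxConfig (n + 1) ℓ u, ‖nbodyQ ℓ u i F X‖ ^ 2) ≤ ∫ X in boxConfig (n + 1) ℓ u, ‖nbodyQ ℓ u i Φ X‖ ^ 2 := by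
    intro i hi
    have hij : i ≠ j := (Finset.mem_filter.mp hi).2
    rw [integral_norm_sq_eq_toReal (hQFm i).aestronglyMeasurable,
      integral_norm_sq_eq_toReal (measurable_nbodyQ ℓ u i hΦm).aestronglyMeasurable]
    exact ENNReal.toReal_mono (lintegral_ne_top_of_memLp_two (memLp_nbodyQ hℓ i hΦm hΦ2))
      (lintegral_nbodyQ_nbodyP_sq_le hℓ hij hΦm (integrable_of_memLp_two hΦ2))
  have hSle := Finset.sum_le_sum hQle
  have hS0 : 0 ≤ ∑ i : Fin (n + 1) with i ≠ j, ∫ X in boxConfig (n + 1) ℓ u, ‖nbodyQ ℓ u i F X‖ ^ 2 :=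
    Finset.sum_nonneg fun i _ => integral_nonneg fun X => by positivity
  have hm0 : (0 : ℝ) ≤ ((n + 1 : ℕ) - 1 : ℝ) := by push_cast; linarith
  rw [hexp, hS]
  have hcross : -(2 * (α * β) * ∑ i : Fin (n + 1) with i ≠ j, ∫ X in boxConfig (n + 1) ℓ u, ‖nbodyQ ℓ u i F X‖ ^ 2) ≤
      2 * |α| * β * ∑ i : Fin (n + 1) with i ≠ j, ∫ X in boxConfig (n + 1) ℓ u, ‖nbodyQ ℓ u i F X‖ ^ 2 := by
    have h1 : -(α * β) ≤ |α| * β := by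
      rw [← neg_mul]
      exact mul_le_mul_of_nonneg_right (neg_le_abs α) hβ0.le
    have h2 := mul_le_mul_of_nonneg_right h1 hS0
    linarith
  have e1 := mul_le_mul_of_nonneg_left hGle (sq_nonneg β)
  have e2 := mul_le_mul_of_nonneg_left hSle (mul_nonneg (sq_nonneg β) hm0)
  have e3 := mul_le_mul_of_nonneg_left hSle (by positivity : (0 : ℝ) ≤ 2 * |α| * β)
  linarith

end OneQ

/-! ### The expectations of the statement as sums of pair and one-body integrals -/

section Conversions

variable {Φ : Config (n + 1) → ℂ} {K K₁ : ℝ≥0∞}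

/-- **The repulsion over ordered pairs**: `⟨Φ, ∑_{i<j}w(xᵢ,xⱼ)Φ⟩ = ½∑ᵢ∑_{j≠i}∫w(xᵢ,xⱼ)|Φ|²`.
[cite: Fournais2020, (2.6), (2.22)] -/
theorem toReal_rep_eq (hχ : IsLocalizationFunction χ) (hvm : Measurable v) (hΦm : Measurable Φ)
    (hrep : (∫⁻ X in boxConfig (n + 1) ℓ u, repBoxN v χ ℓ u X * (‖Φ X‖₊ : ℝ≥0∞) ^ 2) ≠ ⊤) :
    (∫⁻ X in boxConfig (n + 1) ℓ u, repBoxN v χ ℓ u X * (‖Φ X‖₊ : ℝ≥0∞) ^ 2).toReal =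
      2⁻¹ * ∑ i : Fin (n + 1), ∑ j : Fin (n + 1) with j ≠ i,
        ∫ X in boxConfig (n + 1) ℓ u, (pairLoc v χ ℓ u (X i) (X j)).toReal * ‖Φ X‖ ^ 2 := by
  have hw := measurable_pairLoc₂ hvm hχ ℓ u
  have hπ : ∀ i j : Fin (n + 1), Measurable fun X : Config (n + 1) => (X i, X j) :=
    fun i j => (measurable_pi_apply i).prodMk (measurable_pi_apply j)
  have hwij : ∀ i j : Fin (n + 1), Measurable fun X : Config (n + 1) => pairLoc v χ ℓ u (X i) (X j) :=
    fun i j => by have h := hw.comp (hπ i j); exact h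
  have hΦn : Measurable fun X : Config (n + 1) => (‖Φ X‖₊ : ℝ≥0∞) ^ 2 := hΦm.nnnorm.coe_nnreal_ennreal.pow_const _
  -- split the `ℝ≥0∞` integral over the pairs `i < j`
  have h1 : ∫⁻ X in boxConfig (n + 1) ℓ u, repBoxN v χ ℓ u X * (‖Φ X‖₊ : ℝ≥0∞) ^ 2 =
      ∑ i : Fin (n + 1), ∑ j : Fin (n + 1) with i < j,
        ∫⁻ X in boxConfig (n + 1) ℓ u, pairLoc v χ ℓ u (X i) (X j) * (‖Φ X‖₊ : ℝ≥0∞) ^ 2 := by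
    simp only [repBoxN, Finset.sum_mul]
    rw [lintegral_finsetSum (f := fun i X => ∑ j : Fin (n + 1) with i < j,
      pairLoc v χ ℓ u (X i) (X j) * (‖Φ X‖₊ : ℝ≥0∞) ^ 2) _
      fun i _ => Finset.measurable_sum _ fun j _ => (hwij i j).mul hΦn]
    refine Finset.sum_congr rfl fun i _ => ?_
    rw [lintegral_finsetSum (f := fun j X => pairLoc v χ ℓ u (X i) (X j) * (‖Φ X‖₊ : ℝ≥0∞) ^ 2) _
      fun j _ => (hwij i j).mul hΦn]
  have hfin : ∀ i j : Fin (n + 1), i ≠ j →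
      ∫⁻ X in boxConfig (n + 1) ℓ u, pairLoc v χ ℓ u (X i) (X j) * (‖Φ X‖₊ : ℝ≥0∞) ^ 2 ≠ ⊤ :=
    fun i j hij => ne_top_of_le_ne_top hrep (lintegral_mono fun X =>
      mul_le_mul' (pairLoc_le_repBoxN hχ ℓ u hij X) le_rfl)
  rw [h1, ENNReal.toReal_sum fun i _ => ENNReal.sum_ne_top.mpr fun j hj =>
    hfin i j (ne_of_lt (Finset.mem_filter.mp hj).2)]
  simp only [ENNReal.toReal_sum fun j hj => hfin _ j (ne_of_lt (Finset.mem_filter.mp hj).2)]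
  have h2 : ∀ i j : Fin (n + 1), i ≠ j →
      (∫⁻ X in boxConfig (n + 1) ℓ u, pairLoc v χ ℓ u (X i) (X j) * (‖Φ X‖₊ : ℝ≥0∞) ^ 2).toReal =
        ∫ X in boxConfig (n + 1) ℓ u, (pairLoc v χ ℓ u (X i) (X j)).toReal * ‖Φ X‖ ^ 2 :=
    fun i j hij => (integral_toReal_mul_norm_sq (hwij i j).aemeasurable hΦm.aestronglyMeasurable
      (hfin i j hij)).symm
  rw [sum_sum_filter_ne_eq_two_mul (g := fun i j => ∫ X in boxConfig (n + 1) ℓ u,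
    (pairLoc v χ ℓ u (X i) (X j)).toReal * ‖Φ X‖ ^ 2) (fun i j => by
      exact integral_congr_ae (Filter.Eventually.of_forall fun X => by
        simp only [pairLoc_comm hχ ℓ u (X i) (X j)]))]
  rw [← mul_assoc, inv_mul_cancel₀ two_ne_zero, one_mul]
  refine Finset.sum_congr rfl fun i _ => Finset.sum_congr rfl fun j hj => ?_
  exact h2 i j (ne_of_lt (Finset.mem_filter.mp hj).2)

/-- **The attraction as one-body integrals**: `⟨Φ, ρ_μ∑ₖ∫w₁(xₖ,y)dy Φ⟩ = ρ_μ∑ₖ∫U(xₖ)|Φ|²`.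
[cite: Fournais2020, (2.6), (2.22)] -/
theorem toReal_attr_eq (hω : IsScatteringSolution v ω) (hχ : IsLocalizationFunction χ) (hvm : Measurable v)
    (hℓ : 0 < ℓ) {ρμ : ℝ} (hρ : 0 ≤ ρμ)
    (hK₁ : ∀ x, ∫⁻ y in slidingBox ℓ u, pairLoc₁ v ω χ ℓ u y x ≤ K₁) (hK₁' : K₁ ≠ ⊤)
    (hΦm : Measurable Φ) (hΦ2 : MemLp Φ 2 (volume.restrict (boxConfig (n + 1) ℓ u))) :
    (∫⁻ X in boxConfig (n + 1) ℓ u, attrBoxN v ω χ ℓ ρμ u X * (‖Φ X‖₊ : ℝ≥0∞) ^ 2).toReal =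
      ρμ * ∑ k : Fin (n + 1), ∫ X in boxConfig (n + 1) ℓ u,
        (∫⁻ y, pairLoc₁ v ω χ ℓ u (X k) y).toReal * ‖Φ X‖ ^ 2 := by
  have hUm := measurable_lintegral_pairLoc₁ hω hχ hvm ℓ u
  have hUk : ∀ k : Fin (n + 1), Measurable fun X : Config (n + 1) => ∫⁻ y, pairLoc₁ v ω χ ℓ u (X k) y :=
    fun k => hUm.comp (measurable_pi_apply k)
  have hUb : ∀ x, ∫⁻ y, pairLoc₁ v ω χ ℓ u x y ≤ K₁ := lintegral_pairLoc₁_le_of_kbound hω hχ hℓ hK₁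
  have hΦn : Measurable fun X : Config (n + 1) => (‖Φ X‖₊ : ℝ≥0∞) ^ 2 := hΦm.nnnorm.coe_nnreal_ennreal.pow_const _
  have h1 : ∫⁻ X in boxConfig (n + 1) ℓ u, attrBoxN v ω χ ℓ ρμ u X * (‖Φ X‖₊ : ℝ≥0∞) ^ 2 =
      ENNReal.ofReal ρμ * ∑ k : Fin (n + 1),
        ∫⁻ X in boxConfig (n + 1) ℓ u, (∫⁻ y, pairLoc₁ v ω χ ℓ u (X k) y) * (‖Φ X‖₊ : ℝ≥0∞) ^ 2 := by
    have hsm : Measurable fun X : Config (n + 1) =>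
        ∑ k : Fin (n + 1), (∫⁻ y, pairLoc₁ v ω χ ℓ u (X k) y) * (‖Φ X‖₊ : ℝ≥0∞) ^ 2 :=
      Finset.measurable_sum _ fun k _ => (hUk k).mul hΦn
    simp only [attrBoxN, mul_assoc, Finset.sum_mul]
    rw [lintegral_const_mul _ hsm, lintegral_finsetSum
      (f := fun k X => (∫⁻ y, pairLoc₁ v ω χ ℓ u (X k) y) * (‖Φ X‖₊ : ℝ≥0∞) ^ 2) _ fun k _ => (hUk k).mul hΦn]
  have hfin : ∀ k : Fin (n + 1),
      ∫⁻ X in boxConfig (n + 1) ℓ u, (∫⁻ y, pairLoc₁ v ω χ ℓ u (X k) y) * (‖Φ X‖₊ : ℝ≥0∞) ^ 2 ≠ ⊤ := by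
    intro k
    refine ne_top_of_le_ne_top (ENNReal.mul_ne_top hK₁' (lintegral_ne_top_of_memLp_two hΦ2)) ?_
    rw [← lintegral_const_mul _ hΦn]
    exact lintegral_mono fun X => mul_le_mul' (hUb _) le_rfl
  rw [h1, ENNReal.toReal_mul, ENNReal.toReal_ofReal hρ, ENNReal.toReal_sum fun k _ => hfin k]
  congr 1
  refine Finset.sum_congr rfl fun k _ => ?_
  exact (integral_toReal_mul_norm_sq (hUk k).aemeasurable hΦm.aestronglyMeasurable (hfin k)).symm

/-- **`⟨Φ, n₊Φ⟩ = ∑ₖ‖QₖΦ‖²`** in real form. [cite: Fournais2020, (2.15)] -/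
theorem toReal_nPlusBoxN_eq (hℓ : 0 < ℓ) (hΦm : Measurable Φ)
    (hΦ2 : MemLp Φ 2 (volume.restrict (boxConfig (n + 1) ℓ u))) :
    (nPlusBoxN ℓ u Φ).toReal = ∑ k : Fin (n + 1), ∫ X in boxConfig (n + 1) ℓ u, ‖nbodyQ ℓ u k Φ X‖ ^ 2 := by
  rw [nPlusBoxN_eq_sum_lintegral hℓ u hΦm, ENNReal.toReal_sum fun k _ =>
    lintegral_ne_top_of_memLp_two (memLp_nbodyQ hℓ k hΦm hΦ2)]
  refine Finset.sum_congr rfl fun k _ => ?_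
  exact (integral_norm_sq_eq_toReal (measurable_nbodyQ ℓ u k hΦm).aestronglyMeasurable).symm

/-- **`⟨Φ, A₂Φ⟩` in real form**: `a2Form = ∑ᵢ∑_{j≠i}∫w₁(xᵢ,xⱼ)Re(conj(PᵢPⱼΦ)QⱼQᵢΦ)`.
[cite: Fournais2020, (2.24)] -/
theorem a2Form_eq (hℓ : 0 < ℓ) (hω : IsScatteringSolution v ω) (hχ : IsLocalizationFunction χ)
    (hvm : Measurable v) (hK : ∀ x, ∫⁻ y in slidingBox ℓ u, pairLoc v χ ℓ u y x ≤ K) (hK' : K ≠ ⊤)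
    (hΦm : Measurable Φ) (hΦ2 : MemLp Φ 2 (volume.restrict (boxConfig (n + 1) ℓ u)))
    (hrep : (∫⁻ X in boxConfig (n + 1) ℓ u, repBoxN v χ ℓ u X * (‖Φ X‖₊ : ℝ≥0∞) ^ 2) ≠ ⊤) :
    a2Form v ω χ ℓ u Φ = ∑ i : Fin (n + 1), ∑ j : Fin (n + 1) with j ≠ i,
      ∫ X in boxConfig (n + 1) ℓ u, (pairLoc₁ v ω χ ℓ u (X i) (X j)).toReal *
        (conj (nbodyP ℓ u i (nbodyP ℓ u j Φ) X) * nbodyQ ℓ u j (nbodyQ ℓ u i Φ) X).re := by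
  unfold a2Form
  refine Finset.sum_congr rfl fun i _ => Finset.sum_congr rfl fun j hj => ?_
  have hij : i ≠ j := fun h => (Finset.mem_filter.mp hj).2 h.symm
  have hw₁ := measurable_pairLoc₁₂ hvm hω.measurable hχ ℓ u
  have hπ : Measurable fun X : Config (n + 1) => (X i, X j) :=
    (measurable_pi_apply i).prodMk (measurable_pi_apply j)
  have hw₁ij : AEMeasurable (fun X : Config (n + 1) => pairLoc₁ v ω χ ℓ u (X i) (X j))
      (volume.restrict (boxConfig (n + 1) ℓ u)) := (hw₁.comp hπ).aemeasurable
  have hfin : ∫⁻ X in boxConfig (n + 1) ℓ u, pairLoc v χ ℓ u (X i) (X j) * (‖Φ X‖₊ : ℝ≥0∞) ^ 2 ≠ ⊤ :=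
    ne_top_of_le_ne_top hrep (lintegral_mono fun X => mul_le_mul' (pairLoc_le_repBoxN hχ ℓ u hij X) le_rfl)
  have mono₁ : ∀ X : Config (n + 1), pairLoc₁ v ω χ ℓ u (X i) (X j) ≤ pairLoc v χ ℓ u (X i) (X j) :=
    fun X => pairLoc₁_le_pairLoc hω χ ℓ u _ _
  have fpp := lintegral_mul_norm_sq_ne_top_mono mono₁
    (lintegral_pairLoc_nbodyPP_ne_top hℓ hχ hvm hK hK' hΦm hΦ2 hij)
  have fq := lintegral_mul_norm_sq_ne_top_mono mono₁
    (lintegral_pairLoc_nbodyQQ_ne_top hℓ hχ hvm hK hK' hΦm hΦ2 hij hfin)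
  have hI := integrable_toReal_mul_conj_mul hw₁ij
    (measurable_nbodyP ℓ u i (measurable_nbodyP ℓ u j hΦm)).aestronglyMeasurable
    (measurable_nbodyQ ℓ u j (measurable_nbodyQ ℓ u i hΦm)).aestronglyMeasurable fpp fq
  have h1 : ∀ X, conj (nbodyP ℓ u i (nbodyP ℓ u j Φ) X) * ((pairLoc₁ v ω χ ℓ u (X i) (X j)).toReal : ℂ) *
      nbodyQ ℓ u j (nbodyQ ℓ u i Φ) X =
      ((pairLoc₁ v ω χ ℓ u (X i) (X j)).toReal : ℂ) *
        (conj (nbodyP ℓ u i (nbodyP ℓ u j Φ) X) * nbodyQ ℓ u j (nbodyQ ℓ u i Φ) X) := fun X => by ring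
  simp only [h1]
  have h := integral_re hI
  simp only [RCLike.re_to_complex, Complex.re_ofReal_mul] at h
  rw [← h]

end Conversions

/-! ### The arithmetic of (2.25) -/

section Arithmetic

/-- **The coefficient of `‖Φ‖²` in (2.25).** With `t = ℓ⁻³`, `λ = ℓ³/(4m)`, `α = (m-1)t - ρ_μ`:
`E - 10πa(ρ_μ + mt) ≤ ½t(8πa + J)(m² - m) - 8πaρ_μm - λ·8πa·α²·m` for the main term
`E = (m²/(2ℓ³))(8πa + J) - (ρ_μm/ℓ³ + ¼(ρ_μ - m/ℓ³)²)8πaℓ³` of (2.25) (`0 ≤ J = ∫gω ≤ 8πa`, `m ≥ 1`):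
the passage from `(ρ_μ - (n₀-1)/ℓ³)²` in (2.23) to `(ρ_μ - n/ℓ³)²` in (2.25). [cite: Fournais2020, (2.23)–(2.25)] -/
theorem eq225_coefN2 {a ℓ ρμ m J lam α : ℝ} (ha : 0 < a) (hℓ : 0 < ℓ) (hρ : 0 < ρμ) (hm : 1 ≤ m)
    (hJ0 : 0 ≤ J) (hJ : J ≤ 8 * Real.pi * a) (hlam : lam = ℓ ^ 3 / (4 * m))
    (hα : α = (m - 1) * (ℓ ^ 3)⁻¹ - ρμ) :
    m ^ 2 / (2 * ℓ ^ 3) * (8 * Real.pi * a + J) -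
          (ρμ * m / ℓ ^ 3 + 4⁻¹ * (ρμ - m / ℓ ^ 3) ^ 2) * (8 * Real.pi * a * ℓ ^ 3) -
        10 * Real.pi * a * (ρμ + m * (ℓ ^ 3)⁻¹) ≤
      2⁻¹ * (ℓ ^ 3)⁻¹ * (8 * Real.pi * a + J) * (m ^ 2 - m) - 8 * Real.pi * a * ρμ * m -
        lam * (8 * Real.pi * a) * α ^ 2 * m := by
  have hm0 : 0 < m := by linarith
  have hℓ3 : 0 < ℓ ^ 3 := by positivity
  subst hlam hα
  have key : 2⁻¹ * (ℓ ^ 3)⁻¹ * (8 * Real.pi * a + J) * (m ^ 2 - m) - 8 * Real.pi * a * ρμ * m -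
        ℓ ^ 3 / (4 * m) * (8 * Real.pi * a) * ((m - 1) * (ℓ ^ 3)⁻¹ - ρμ) ^ 2 * m -
      (m ^ 2 / (2 * ℓ ^ 3) * (8 * Real.pi * a + J) -
          (ρμ * m / ℓ ^ 3 + 4⁻¹ * (ρμ - m / ℓ ^ 3) ^ 2) * (8 * Real.pi * a * ℓ ^ 3) -
        10 * Real.pi * a * (ρμ + m * (ℓ ^ 3)⁻¹)) =
      (ℓ ^ 3)⁻¹ * ((m - 1) * (10 * Real.pi * a - J / 2)) + (ℓ ^ 3)⁻¹ * (8 * Real.pi * a - J / 2) +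
        6 * Real.pi * a * ρμ := by
    field_simp
    ring
  have h1 : 0 ≤ (m - 1) * (10 * Real.pi * a - J / 2) := mul_nonneg (by linarith) (by nlinarith [Real.pi_pos])
  have h2 : 0 ≤ 8 * Real.pi * a - J / 2 := by nlinarith [Real.pi_pos]
  rw [← sub_nonneg, key]
  exact add_nonneg (add_nonneg (mul_nonneg (inv_nonneg.2 hℓ3.le) h1) (mul_nonneg (inv_nonneg.2 hℓ3.le) h2))
    (by positivity)

/-- **The coefficient of `n₊` in (2.25)**: all the `n₊`-errors are `≤ (22π + 8k)a(ρ_μ + m/ℓ³)` with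
`k a = sup_x∫w₁(x,y)dy` (`k = 32π‖χ‖²_∞`), `cA = 2|α|ℓ⁻³ + (m-1)ℓ⁻⁶` the constant of the one-`Q`
square. [cite: Fournais2020, (2.22), (2.25)] -/
theorem eq225_coefNp {a ℓ ρμ m J k lam α cA : ℝ} (ha : 0 < a) (hℓ : 0 < ℓ) (hρ : 0 < ρμ) (hm : 1 ≤ m)
    (hk : 0 ≤ k) (hJ0 : 0 ≤ J) (hJ : J ≤ 8 * Real.pi * a) (hlam : lam = ℓ ^ 3 / (4 * m))
    (hα : α = (m - 1) * (ℓ ^ 3)⁻¹ - ρμ) (hcA : cA = 2 * |α| * (ℓ ^ 3)⁻¹ + (ℓ ^ 3)⁻¹ ^ 2 * (m - 1)) :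
    (ℓ ^ 3)⁻¹ * (8 * Real.pi * a + J) * (m - 1) + 4 * ((ℓ ^ 3)⁻¹ * (k * a)) * (m - 1) + ρμ * (k * a) +
        lam * (8 * Real.pi * a) * (cA * (m - 1)) + lam⁻¹ * (k * a) ≤
      (22 * Real.pi + 8 * k) * a * (ρμ + m * (ℓ ^ 3)⁻¹) := by
  have hm0 : 0 < m := by linarith
  have hℓ3 : 0 < ℓ ^ 3 := by positivity
  set t := (ℓ ^ 3)⁻¹ with ht
  have ht0 : 0 < t := by positivity
  have hlt : ℓ ^ 3 * t = 1 := by rw [ht, mul_inv_cancel₀ hℓ3.ne']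
  -- `|α| ≤ (m-1)t + ρμ`
  have hαb : |α| ≤ (m - 1) * t + ρμ := by
    rw [hα]
    refine abs_sub_le_iff.mpr ⟨by nlinarith [mul_nonneg (by linarith : (0:ℝ) ≤ m - 1) ht0.le], by nlinarith [mul_nonneg (by linarith : (0:ℝ) ≤ m - 1) ht0.le]⟩
  have hcA0 : 0 ≤ cA := by rw [hcA]; positivity
  -- `λ·8πa·cA·(m-1) ≤ 2πaℓ³cA = 4πa|α| + 2πa(m-1)t`
  have h1 : lam * (8 * Real.pi * a) * (cA * (m - 1)) ≤ 2 * Real.pi * a * ℓ ^ 3 * cA := by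
    rw [hlam]
    have : ℓ ^ 3 / (4 * m) * (8 * Real.pi * a) * (cA * (m - 1)) = 2 * Real.pi * a * ℓ ^ 3 * cA * ((m - 1) / m) := by
      field_simp
      ring
    rw [this]
    have hfrac : (m - 1) / m ≤ 1 := by rw [div_le_one hm0]; linarith
    have h0 : 0 ≤ 2 * Real.pi * a * ℓ ^ 3 * cA := by positivity
    nlinarith
  have h2 : 2 * Real.pi * a * ℓ ^ 3 * cA = 4 * Real.pi * a * |α| + 2 * Real.pi * a * (m - 1) * t := by
    rw [hcA]
    have : ℓ ^ 3 * t ^ 2 = t := by rw [sq, ← mul_assoc, hlt, one_mul]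
    linear_combination (2 * Real.pi * a * 2 * |α|) * hlt + (2 * Real.pi * a * (m - 1)) * this
  -- `λ⁻¹ k a = 4 m t k a`
  have h3 : lam⁻¹ * (k * a) = 4 * m * t * (k * a) := by
    rw [hlam, inv_div]
    field_simp
    linear_combination (-k) * hlt
  rw [h3]
  have e1 : (ℓ ^ 3)⁻¹ * (8 * Real.pi * a + J) * (m - 1) ≤ t * (16 * Real.pi * a) * m := by
    rw [← ht]
    have : (8 * Real.pi * a + J) * (m - 1) ≤ (16 * Real.pi * a) * m := by nlinarith [Real.pi_pos]
    nlinarith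
  have e2 : 4 * ((ℓ ^ 3)⁻¹ * (k * a)) * (m - 1) ≤ 4 * t * k * a * m := by rw [← ht]; nlinarith [mul_nonneg (mul_nonneg ht0.le hk) ha.le]
  have e3 : 4 * Real.pi * a * |α| ≤ 4 * Real.pi * a * ((m - 1) * t + ρμ) := by nlinarith [Real.pi_pos, abs_nonneg α]
  have e4 : 2 * Real.pi * a * (m - 1) * t ≤ 2 * Real.pi * a * m * t := by nlinarith [Real.pi_pos]
  have e5 : 4 * Real.pi * a * ((m - 1) * t) ≤ 4 * Real.pi * a * (m * t) := by nlinarith [Real.pi_pos]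
  nlinarith [h1, h2, e1, e2, e3, e4, e5, Real.pi_pos, mul_pos ha ht0, mul_pos hρ ha, mul_nonneg hk ha.le,
    mul_nonneg (mul_nonneg hk ha.le) hρ.le, mul_nonneg (mul_nonneg hk ha.le) (mul_nonneg hm0.le ht0.le)]

/-- **The bookkeeping of (2.25)**: the repulsion minus the attraction, decomposed over ordered
pairs by the pair inequality (`PairSum ≥ T0 + 2A₂ + 2Cr - 2T2`), with the `0Q` term `T0`, the
`2Q` error `T2`, the cross terms `Cr = 2ℓ⁻³Cs`, the attraction `ρ_μ(8πa SP + SQ + 2Ds)` and the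
completed one-`Q` square (`hOneQ`), dominates `A₂ + E‖Φ‖² - C a(ρ_μ + m/ℓ³)(n₊ + ‖Φ‖²)` with
`C = 32π + 8k`. Linear arithmetic in the aggregate quantities. [cite: Fournais2020, (2.22)–(2.25)] -/
theorem eq225_combine {a ℓ ρμ m J k lam α cA E : ℝ}
    {Rep Attr PairSum T0s A2 Crs T2s Cs SP SQ Ds N2 Np : ℝ}
    (hRep : Rep = 2⁻¹ * PairSum)
    (hPair : T0s + 2 * A2 + 2 * Crs - 2 * T2s ≤ PairSum)
    (hT0 : (ℓ ^ 3)⁻¹ * (8 * Real.pi * a + J) * ((m ^ 2 - m) * N2 - 2 * (m - 1) * Np) ≤ T0s)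
    (hT2 : T2s ≤ 4 * ((ℓ ^ 3)⁻¹ * (k * a)) * (m - 1) * Np)
    (hCr : Crs = 2 * ((ℓ ^ 3)⁻¹ * Cs))
    (hAttr : Attr = ρμ * (8 * Real.pi * a * SP + SQ + 2 * Ds))
    (f1 : 8 * Real.pi * a * ρμ * SP ≤ 8 * Real.pi * a * ρμ * (m * N2))
    (f3 : ρμ * SQ ≤ ρμ * (k * a * Np))
    (hOneQ : -(lam * (8 * Real.pi * a) * (α ^ 2 * SP + cA * ((m - 1) * Np))) - lam⁻¹ * (k * a) * Np ≤
      2 * ((ℓ ^ 3)⁻¹ * Cs) - 2 * (ρμ * Ds))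
    (f2 : lam * (8 * Real.pi * a) * α ^ 2 * SP ≤ lam * (8 * Real.pi * a) * α ^ 2 * (m * N2))
    (P1 : (E - 10 * Real.pi * a * (ρμ + m * (ℓ ^ 3)⁻¹)) * N2 ≤
      (2⁻¹ * (ℓ ^ 3)⁻¹ * (8 * Real.pi * a + J) * (m ^ 2 - m) - 8 * Real.pi * a * ρμ * m -
        lam * (8 * Real.pi * a) * α ^ 2 * m) * N2)
    (P2 : ((ℓ ^ 3)⁻¹ * (8 * Real.pi * a + J) * (m - 1) + 4 * ((ℓ ^ 3)⁻¹ * (k * a)) * (m - 1) + ρμ * (k * a) +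
        lam * (8 * Real.pi * a) * (cA * (m - 1)) + lam⁻¹ * (k * a)) * Np ≤
      (22 * Real.pi + 8 * k) * a * (ρμ + m * (ℓ ^ 3)⁻¹) * Np)
    (g1 : 0 ≤ a * (ρμ + m * (ℓ ^ 3)⁻¹) * N2) (g1' : 0 ≤ k * (a * (ρμ + m * (ℓ ^ 3)⁻¹) * N2))
    (g2 : 0 ≤ a * (ρμ + m * (ℓ ^ 3)⁻¹) * Np) :
    A2 + E * N2 - (32 * Real.pi + 8 * k) * a * (ρμ + m * (ℓ ^ 3)⁻¹) * (Np + N2) ≤ Rep - Attr := by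
  rw [hRep, hAttr]
  rw [hCr] at hPair
  nlinarith [hPair, hT0, hT2, f1, f3, hOneQ, f2, P1, P2, g1, g1', g2, Real.pi_pos, mul_nonneg Real.pi_pos.le g1,
    mul_nonneg Real.pi_pos.le g2]

end Arithmetic

/-! ### Sums over ordered pairs of one-particle quantities -/

section PairSums

variable {m : ℕ}

/-- `∑ᵢ ∑_{j ≠ i} f i = (m - 1) ∑ᵢ f i`. [folklore] -/
theorem sum_sum_filter_ne_left (f : Fin m → ℝ) :
    ∑ i : Fin m, ∑ j : Fin m with j ≠ i, f i = ((m : ℝ) - 1) * ∑ i : Fin m, f i := by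
  rw [Finset.mul_sum]
  refine Finset.sum_congr rfl fun i _ => ?_
  rw [Finset.sum_const, Finset.filter_ne', Finset.card_erase_of_mem (Finset.mem_univ i), Finset.card_univ,
    Fintype.card_fin, nsmul_eq_mul, Nat.cast_sub (Fin.pos i), Nat.cast_one]

/-- `∑ᵢ ∑_{j ≠ i} f j = (m - 1) ∑ᵢ f i`. [folklore] -/
theorem sum_sum_filter_ne_right (f : Fin m → ℝ) :
    ∑ i : Fin m, ∑ j : Fin m with j ≠ i, f j = ((m : ℝ) - 1) * ∑ i : Fin m, f i := by
  rw [sum_sum_filter_ne_comm (fun _ j => f j)]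
  exact sum_sum_filter_ne_left f

/-- `∑ᵢ ∑_{j ≠ i} c = (m² - m) c`. [folklore] -/
theorem sum_sum_filter_ne_const (c : ℝ) :
    ∑ i : Fin m, ∑ j : Fin m with j ≠ i, c = ((m : ℝ) ^ 2 - m) * c := by
  rw [sum_sum_filter_ne_left (fun _ => c), Finset.sum_const, Finset.card_univ, Fintype.card_fin, nsmul_eq_mul]
  ring

/-- The sum over ordered pairs of `c(N - N_j - N_i)` (the `0Q` bookkeeping). [folklore] -/
theorem sum_pair_main (c N : ℝ) (Nq : Fin m → ℝ) :
    ∑ i : Fin m, ∑ j : Fin m with j ≠ i, c * (N - Nq j - Nq i) =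
      c * (((m : ℝ) ^ 2 - m) * N - 2 * ((m : ℝ) - 1) * ∑ k : Fin m, Nq k) := by
  simp only [← Finset.mul_sum, Finset.sum_sub_distrib]
  rw [sum_sum_filter_ne_const, sum_sum_filter_ne_right, sum_sum_filter_ne_left]
  ring

/-- The sum over ordered pairs of `c(N_i + N_j)` (the `2Q` bookkeeping). [folklore] -/
theorem sum_pair_add (c : ℝ) (Nq : Fin m → ℝ) :
    ∑ i : Fin m, ∑ j : Fin m with j ≠ i, c * (Nq i + Nq j) = c * (2 * ((m : ℝ) - 1) * ∑ k : Fin m, Nq k) := by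
  simp only [← Finset.mul_sum, Finset.sum_add_distrib]
  rw [sum_sum_filter_ne_right, sum_sum_filter_ne_left]
  ring

end PairSums

/-! ### The operator `A_j` as a function on `Λⁿ⁺¹` -/

section Aj

variable {Φ : Config (n + 1) → ℂ}

/-- `A_j` is measurable. [cite: Fournais2020, (2.22)] -/
theorem measurable_oneQ_A (ℓ : ℝ) (u : Space) (ρμ : ℝ) (k : Fin (n + 1)) (hΦm : Measurable Φ) :
    Measurable fun X => ((((ℓ ^ 3)⁻¹ : ℝ) : ℂ) * (∑ i : Fin (n + 1) with i ≠ k, nbodyP ℓ u i (nbodyP ℓ u k Φ) X) - (ρμ : ℂ) * nbodyP ℓ u k Φ X) :=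
  ((Finset.measurable_sum _ fun i _ => measurable_nbodyP ℓ u i (measurable_nbodyP ℓ u k hΦm)).const_mul _).sub
    ((measurable_nbodyP ℓ u k hΦm).const_mul _)

/-- `A_j ∈ L²`. [cite: Fournais2020, (2.22)] -/
theorem memLp_oneQ_A (hℓ : 0 < ℓ) (ρμ : ℝ) (k : Fin (n + 1)) (hΦm : Measurable Φ)
    (hΦ2 : MemLp Φ 2 (volume.restrict (boxConfig (n + 1) ℓ u))) :
    MemLp (fun X => ((((ℓ ^ 3)⁻¹ : ℝ) : ℂ) * (∑ i : Fin (n + 1) with i ≠ k, nbodyP ℓ u i (nbodyP ℓ u k Φ) X) - (ρμ : ℂ) * nbodyP ℓ u k Φ X)) 2 (volume.restrict (boxConfig (n + 1) ℓ u)) := by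
  have hPk := memLp_nbodyP hℓ k hΦm hΦ2
  have hPkm := measurable_nbodyP ℓ u k hΦm
  exact ((memLp_finsetSum _ fun i _ => memLp_nbodyP hℓ i hPkm hPk).const_mul _).sub (hPk.const_mul _)

/-- `A_j` does not depend on `xⱼ`. [cite: Fournais2020, (2.22)] -/
theorem oneQ_A_update (ℓ : ℝ) (u : Space) (ρμ : ℝ) (k : Fin (n + 1)) (Φ : Config (n + 1) → ℂ)
    (X : Config (n + 1)) (y : Space) :
    (fun X => ((((ℓ ^ 3)⁻¹ : ℝ) : ℂ) * (∑ i : Fin (n + 1) with i ≠ k, nbodyP ℓ u i (nbodyP ℓ u k Φ) X) - (ρμ : ℂ) * nbodyP ℓ u k Φ X)) (Function.update X k y) = (fun X => ((((ℓ ^ 3)⁻¹ : ℝ) : ℂ) * (∑ i : Fin (n + 1) with i ≠ k, nbodyP ℓ u i (nbodyP ℓ u k Φ) X) - (ρμ : ℂ) * nbodyP ℓ u k Φ X)) X := by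
  simp only [nbodyP_update]
  congr 2
  refine Finset.sum_congr rfl fun i hi => ?_
  exact nbodyP_nbodyP_update_right ℓ u (Finset.mem_filter.mp hi).2 Φ X y

end Aj

/-! ### (2.25) on the `(n+1)`-particle sector -/

section Succ

/-- **(2.25) for `n + 1` particles**, with the constants `C = 32π + 128π‖χ‖²_∞` (after `χ`) and
`R/ℓ ≤ D` where `χ*χ ≥ ½` on `B̄(0,D)`. [cite: Fournais2020, (2.25), Lemma 2.3 (2.22)–(2.24)] -/
theorem eq225_succ (hℓ : 0 < ℓ) (hω : IsScatteringSolution v ω) (hχ : IsLocalizationFunction χ)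
    (hvm : Measurable v) (hsL : scatteringLength v ≠ ⊤) (hsL0 : 0 < scatteringLength v)
    {R D Cχ : ℝ} (hR : ∀ r, R < r → v r = 0) (hCχ : ∀ x, ‖χ x‖ ≤ Cχ)
    (hD : ∀ y : Space, ‖y‖ ≤ D → 2⁻¹ ≤ selfConv χ y) (hRℓ : R / ℓ ≤ D) (hvi : ∫⁻ z : Space, v ‖z‖ ≠ ⊤)
    {ρμ : ℝ} (hρ : 0 < ρμ) {Φ : Config (n + 1) → ℂ} (hΦm : Measurable Φ)
    (hN2 : ∫⁻ X in boxConfig (n + 1) ℓ u, (‖Φ X‖₊ : ℝ≥0∞) ^ 2 ≠ ⊤)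
    (hrep : ∫⁻ X in boxConfig (n + 1) ℓ u, repBoxN v χ ℓ u X * (‖Φ X‖₊ : ℝ≥0∞) ^ 2 ≠ ⊤) :
    a2Form v ω χ ℓ u Φ + (((n + 1 : ℕ) : ℝ) ^ 2 / (2 * ℓ ^ 3) * (8 * Real.pi * (scatteringLength v).toReal + (gOmegaIntegral v ω).toReal) - (ρμ * ((n + 1 : ℕ) : ℝ) / ℓ ^ 3 + 4⁻¹ * (ρμ - ((n + 1 : ℕ) : ℝ) / ℓ ^ 3) ^ 2) * (8 * Real.pi * (scatteringLength v).toReal * ℓ ^ 3)) * (∫⁻ X in boxConfig (n + 1) ℓ u, (‖Φ X‖₊ : ℝ≥0∞) ^ 2).toReal -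
        (32 * Real.pi + 8 * (16 * Real.pi * Cχ ^ 2)) * (scatteringLength v).toReal * (ρμ + ((n + 1 : ℕ) : ℝ) / ℓ ^ 3) * ((nPlusBoxN ℓ u Φ).toReal + (∫⁻ X in boxConfig (n + 1) ℓ u, (‖Φ X‖₊ : ℝ≥0∞) ^ 2).toReal) ≤
      (∫⁻ X in boxConfig (n + 1) ℓ u, repBoxN v χ ℓ u X * (‖Φ X‖₊ : ℝ≥0∞) ^ 2).toReal - (∫⁻ X in boxConfig (n + 1) ℓ u, attrBoxN v ω χ ℓ ρμ u X * (‖Φ X‖₊ : ℝ≥0∞) ^ 2).toReal := by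
  -- constants and regime
  have hCχ0 : 0 ≤ Cχ := (norm_nonneg _).trans (hCχ 0)
  have ha : 0 < (scatteringLength v).toReal := ENNReal.toReal_pos hsL0.ne' hsL
  have hm1 : (1 : ℝ) ≤ ((n + 1 : ℕ) : ℝ) := by exact_mod_cast Nat.succ_pos n
  have hm0 : (0 : ℝ) < ((n + 1 : ℕ) : ℝ) := by linarith
  have hgΩ : gOmegaIntegral v ω ≠ ⊤ :=
    ne_top_of_le_ne_top (ENNReal.mul_ne_top ENNReal.ofReal_ne_top hsL) (gOmegaIntegral_le hω)
  have hJ0 : 0 ≤ (gOmegaIntegral v ω).toReal := ENNReal.toReal_nonneg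
  have hJ : (gOmegaIntegral v ω).toReal ≤ 8 * Real.pi * (scatteringLength v).toReal := by
    have h := ENNReal.toReal_mono (ENNReal.mul_ne_top ENNReal.ofReal_ne_top hsL) (gOmegaIntegral_le hω)
    rwa [ENNReal.toReal_mul, ENNReal.toReal_ofReal (by positivity)] at h
  have hK : ∀ x, ∫⁻ y in slidingBox ℓ u, pairLoc v χ ℓ u y x ≤ (ENNReal.ofReal Cχ * ENNReal.ofReal Cχ * 2 * ∫⁻ z : Space, v ‖z‖) := kbound_pairLoc hχ hR hℓ hCχ hD hRℓ
  have hK' : (ENNReal.ofReal Cχ * ENNReal.ofReal Cχ * 2 * ∫⁻ z : Space, v ‖z‖) ≠ ⊤ := ENNReal.mul_ne_top (by finiteness) hvi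
  have hK₁ : ∀ x, ∫⁻ y in slidingBox ℓ u, pairLoc₁ v ω χ ℓ u y x ≤ (ENNReal.ofReal Cχ * ENNReal.ofReal Cχ * 2 * (ENNReal.ofReal (8 * Real.pi) * scatteringLength v)) := kbound_pairLoc₁ hω hχ hR hℓ hCχ hD hRℓ
  have hK₁' : (ENNReal.ofReal Cχ * ENNReal.ofReal Cχ * 2 * (ENNReal.ofReal (8 * Real.pi) * scatteringLength v)) ≠ ⊤ := ENNReal.mul_ne_top (by finiteness) (ENNReal.mul_ne_top ENNReal.ofReal_ne_top hsL)
  have hK₁r : (ENNReal.ofReal Cχ * ENNReal.ofReal Cχ * 2 * (ENNReal.ofReal (8 * Real.pi) * scatteringLength v)).toReal = (16 * Real.pi * Cχ ^ 2) * (scatteringLength v).toReal := by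
    rw [ENNReal.toReal_mul, ENNReal.toReal_mul, ENNReal.toReal_mul, ENNReal.toReal_mul, ENNReal.toReal_ofReal hCχ0,
      ENNReal.toReal_ofReal (by positivity), ENNReal.toReal_ofNat]
    ring
  have hk0 : 0 ≤ (16 * Real.pi * Cχ ^ 2) := by positivity
  have hΦ2 : MemLp Φ 2 (volume.restrict (boxConfig (n + 1) ℓ u)) := memLp_two_of_lintegral_ne_top hΦm.aestronglyMeasurable hN2
  have hUm := measurable_lintegral_pairLoc₁ hω hχ hvm ℓ u
  have hUb : ∀ x, ∫⁻ y, pairLoc₁ v ω χ ℓ u x y ≤ (ENNReal.ofReal Cχ * ENNReal.ofReal Cχ * 2 * (ENNReal.ofReal (8 * Real.pi) * scatteringLength v)) := lintegral_pairLoc₁_le_of_kbound hω hχ hℓ hK₁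
  have hne : ∀ i j : Fin (n + 1), j ∈ Finset.univ.filter (fun j => j ≠ i) → i ≠ j :=
    fun i j hj h => (Finset.mem_filter.mp hj).2 h.symm
  have hfin : ∀ i j : Fin (n + 1), i ≠ j →
      ∫⁻ X in boxConfig (n + 1) ℓ u, pairLoc v χ ℓ u (X i) (X j) * (‖Φ X‖₊ : ℝ≥0∞) ^ 2 ≠ ⊤ :=
    fun i j hij => ne_top_of_le_ne_top hrep (lintegral_mono fun X =>
      mul_le_mul' (pairLoc_le_repBoxN hχ ℓ u hij X) le_rfl)
  -- real forms of the four expectations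
  have hRep : (∫⁻ X in boxConfig (n + 1) ℓ u, repBoxN v χ ℓ u X * (‖Φ X‖₊ : ℝ≥0∞) ^ 2).toReal = 2⁻¹ * (∑ i : Fin (n + 1), ∑ j : Fin (n + 1) with j ≠ i, ∫ X in boxConfig (n + 1) ℓ u, (pairLoc v χ ℓ u (X i) (X j)).toReal * ‖Φ X‖ ^ 2) := toReal_rep_eq hχ hvm hΦm hrep
  have hAttr0 : (∫⁻ X in boxConfig (n + 1) ℓ u, attrBoxN v ω χ ℓ ρμ u X * (‖Φ X‖₊ : ℝ≥0∞) ^ 2).toReal = ρμ * (∑ k : Fin (n + 1), ∫ X in boxConfig (n + 1) ℓ u, (∫⁻ y, pairLoc₁ v ω χ ℓ u (X k) y).toReal * ‖Φ X‖ ^ 2) := toReal_attr_eq hω hχ hvm hℓ hρ.le hK₁ hK₁' hΦm hΦ2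
  have hNp : (nPlusBoxN ℓ u Φ).toReal = (∑ k : Fin (n + 1), ∫ X in boxConfig (n + 1) ℓ u, ‖nbodyQ ℓ u k Φ X‖ ^ 2) := toReal_nPlusBoxN_eq hℓ hΦm hΦ2
  have hN2r : (∫⁻ X in boxConfig (n + 1) ℓ u, (‖Φ X‖₊ : ℝ≥0∞) ^ 2).toReal = ∫ X in boxConfig (n + 1) ℓ u, ‖Φ X‖ ^ 2 := (integral_norm_sq_eq_toReal hΦm.aestronglyMeasurable).symm
  have hA2 : a2Form v ω χ ℓ u Φ = (∑ i : Fin (n + 1), ∑ j : Fin (n + 1) with j ≠ i, ∫ X in boxConfig (n + 1) ℓ u, (pairLoc₁ v ω χ ℓ u (X i) (X j)).toReal * (conj (nbodyP ℓ u i (nbodyP ℓ u j Φ) X) * nbodyQ ℓ u j (nbodyQ ℓ u i Φ) X).re) := a2Form_eq hℓ hω hχ hvm hK hK' hΦm hΦ2 hrep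
  -- the pair inequality, summed
  have hPair : (∑ i : Fin (n + 1), ∑ j : Fin (n + 1) with j ≠ i, ∫ X in boxConfig (n + 1) ℓ u, (pairLoc₁ v ω χ ℓ u (X i) (X j) * ENNReal.ofReal (1 + ω (X i - X j))).toReal * ‖nbodyP ℓ u i (nbodyP ℓ u j Φ) X‖ ^ 2) + 2 * (∑ i : Fin (n + 1), ∑ j : Fin (n + 1) with j ≠ i, ∫ X in boxConfig (n + 1) ℓ u, (pairLoc₁ v ω χ ℓ u (X i) (X j)).toReal * (conj (nbodyP ℓ u i (nbodyP ℓ u j Φ) X) * nbodyQ ℓ u j (nbodyQ ℓ u i Φ) X).re) + 2 * (∑ i : Fin (n + 1), ∑ j : Fin (n + 1) with j ≠ i, ∫ X in boxConfig (n + 1) ℓ u, (pairLoc₁ v ω χ ℓ u (X i) (X j)).toReal * (conj (nbodyP ℓ u i (nbodyP ℓ u j Φ) X) * (Φ X - nbodyP ℓ u i (nbodyP ℓ u j Φ) X - nbodyQ ℓ u j (nbodyQ ℓ u i Φ) X)).re) - 2 * (∑ i : Fin (n + 1), ∑ j : Fin (n + 1) with j ≠ i, ∫ X in boxConfig (n +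 1) ℓ u, (pairLoc₁ v ω χ ℓ u (X i) (X j)).toReal * ‖(Φ X - nbodyP ℓ u i (nbodyP ℓ u j Φ) X - nbodyQ ℓ u j (nbodyQ ℓ u i Φ) X)‖ ^ 2) ≤ (∑ i : Fin (n + 1), ∑ j : Fin (n + 1) with j ≠ i, ∫ X in boxConfig (n + 1) ℓ u, (pairLoc v χ ℓ u (X i) (X j)).toReal * ‖Φ X‖ ^ 2) := by
    have h0 : ∀ i : Fin (n + 1), ∀ j ∈ Finset.univ.filter (fun j => j ≠ i),
        (∫ X in boxConfig (n + 1) ℓ u, (pairLoc₁ v ω χ ℓ u (X i) (X j) * ENNReal.ofReal (1 + ω (X i - X j))).toReal * ‖nbodyP ℓ u i (nbodyP ℓ u j Φ) X‖ ^ 2) + 2 * (∫ X in boxConfig (n + 1) ℓ u, (pairLoc₁ v ω χ ℓ u (X i) (X j)).toReal * (conj (nbodyP ℓ u i (nbodyP ℓ u j Φ) X) * nbodyQ ℓ u j (nbodyQ ℓ u i Φ) X).re) + 2 * (∫ X in boxConfig (n + 1) ℓ u, (pairLoc₁ v ω χ ℓ u (X i) (X j)).toReal * (conj (nbodyP ℓ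 u i (nbodyP ℓ u j Φ) X) * (Φ X - nbodyP ℓ u i (nbodyP ℓ u j Φ) X - nbodyQ ℓ u j (nbodyQ ℓ u i Φ) X)).re) - 2 * (∫ X in boxConfig (n + 1) ℓ u, (pairLoc₁ v ω χ ℓ u (X i) (X j)).toReal * ‖(Φ X - nbodyP ℓ u i (nbodyP ℓ u j Φ) X - nbodyQ ℓ u j (nbodyQ ℓ u i Φ) X)‖ ^ 2) ≤ ∫ X in boxConfig (n + 1) ℓ u, (pairLoc v χ ℓ u (X i) (X j)).toReal * ‖Φ X‖ ^ 2 :=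
      fun i j hj => pair_master_ineq hℓ hω hχ hvm hK hK' hΦm hΦ2 (hne i j hj) (hfin i j (hne i j hj))
    have h := Finset.sum_le_sum (s := Finset.univ) fun i _ => Finset.sum_le_sum (h0 i)
    simp only [Finset.sum_add_distrib, Finset.sum_sub_distrib, ← Finset.mul_sum] at h
    linarith [h]
  -- the `0Q` term
  have hT0 : (ℓ ^ 3)⁻¹ * (8 * Real.pi * (scatteringLength v).toReal + (gOmegaIntegral v ω).toReal) * ((((n + 1 : ℕ) : ℝ) ^ 2 - ((n + 1 : ℕ) : ℝ)) * (∫ X in boxConfig (n + 1) ℓ u, ‖Φ X‖ ^ 2) - 2 * (((n + 1 : ℕ) : ℝ) - 1) * (∑ k : Fin (n + 1), ∫ X in boxConfig (n + 1) ℓ u, ‖nbodyQ ℓ u k Φ X‖ ^ 2)) ≤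
      (∑ i : Fin (n + 1), ∑ j : Fin (n + 1) with j ≠ i, ∫ X in boxConfig (n + 1) ℓ u, (pairLoc₁ v ω χ ℓ u (X i) (X j) * ENNReal.ofReal (1 + ω (X i - X j))).toReal * ‖nbodyP ℓ u i (nbodyP ℓ u j Φ) X‖ ^ 2) := by
    have hc0 : 0 ≤ ((ℓ ^ 3)⁻¹ * (8 * Real.pi * (scatteringLength v).toReal + (gOmegaIntegral v ω).toReal)) := by positivity
    have h0 : ∀ i : Fin (n + 1), ∀ j ∈ Finset.univ.filter (fun j => j ≠ i),
        ((ℓ ^ 3)⁻¹ * (8 * Real.pi * (scatteringLength v).toReal + (gOmegaIntegral v ω).toReal)) * ((∫ X in boxConfig (n + 1) ℓ u, ‖Φ X‖ ^ 2) - (∫ X in boxConfig (n + 1) ℓ u, ‖nbodyQ ℓ u j Φ X‖ ^ 2) - (∫ X in boxConfig (n + 1) ℓ u, ‖nbodyQ ℓ u i Φ X‖ ^ 2)) ≤ ∫ X in boxConfig (n + 1) ℓ u, (pairLoc₁ v ω χ ℓ u (X i) (X j) * ENNReal.ofReal (1 + ω (X i - X j))).toReal * ‖nbodyP ℓ u i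 (nbodyP ℓ u j Φ) X‖ ^ 2 := by
      intro i j hj
      have hij := hne i j hj
      rw [integral_pairLoc₂_nbodyPP hℓ hω hχ hvm hsL hR hD hRℓ hij hΦm
        (memLp_nbodyP hℓ i (measurable_nbodyP ℓ u j hΦm) (memLp_nbodyP hℓ j hΦm hΦ2))]
      exact mul_le_mul_of_nonneg_left (integral_norm_sq_nbodyPP_ge hℓ hij hΦm hΦ2) hc0
    have h := Finset.sum_le_sum (s := Finset.univ) fun i _ => Finset.sum_le_sum (h0 i)
    have hs := sum_pair_main ((ℓ ^ 3)⁻¹ * (8 * Real.pi * (scatteringLength v).toReal + (gOmegaIntegral v ω).toReal)) (∫ X in boxConfig (n + 1) ℓ u, ‖Φ X‖ ^ 2) (fun k : Fin (n + 1) => ∫ X in boxConfig (n + 1) ℓ u, ‖nbodyQ ℓ u k Φ X‖ ^ 2)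
    beta_reduce at hs
    rw [hs] at h
    exact h
  -- the `2Q` error
  have hT2 : (∑ i : Fin (n + 1), ∑ j : Fin (n + 1) with j ≠ i, ∫ X in boxConfig (n + 1) ℓ u, (pairLoc₁ v ω χ ℓ u (X i) (X j)).toReal * ‖(Φ X - nbodyP ℓ u i (nbodyP ℓ u j Φ) X - nbodyQ ℓ u j (nbodyQ ℓ u i Φ) X)‖ ^ 2) ≤ 4 * ((ℓ ^ 3)⁻¹ * ((16 * Real.pi * Cχ ^ 2) * (scatteringLength v).toReal)) * (((n + 1 : ℕ) : ℝ) - 1) * (∑ k : Fin (n + 1), ∫ X in boxConfig (n + 1) ℓ u, ‖nbodyQ ℓ u k Φ X‖ ^ 2) := by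
    have h0 : ∀ i : Fin (n + 1), ∀ j ∈ Finset.univ.filter (fun j => j ≠ i),
        ∫ X in boxConfig (n + 1) ℓ u, (pairLoc₁ v ω χ ℓ u (X i) (X j)).toReal * ‖(Φ X - nbodyP ℓ u i (nbodyP ℓ u j Φ) X - nbodyQ ℓ u j (nbodyQ ℓ u i Φ) X)‖ ^ 2 ≤ (2 * ((ℓ ^ 3)⁻¹ * (ENNReal.ofReal Cχ * ENNReal.ofReal Cχ * 2 * (ENNReal.ofReal (8 * Real.pi) * scatteringLength v)).toReal)) * ((∫ X in boxConfig (n + 1) ℓ u, ‖nbodyQ ℓ u i Φ X‖ ^ 2) + (∫ X in boxConfig (n + 1) ℓ u, ‖nbodyQ ℓ u j Φ X‖ ^ 2)) :=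
      fun i j hj => integral_pairLoc₁_onePart_le hℓ hω hχ hvm hK₁ hK₁' hK hK' hΦm hΦ2 (hne i j hj)
        (hfin i j (hne i j hj))
    have h := Finset.sum_le_sum (s := Finset.univ) fun i _ => Finset.sum_le_sum (h0 i)
    have hs := sum_pair_add (2 * ((ℓ ^ 3)⁻¹ * (ENNReal.ofReal Cχ * ENNReal.ofReal Cχ * 2 * (ENNReal.ofReal (8 * Real.pi) * scatteringLength v)).toReal)) (fun k : Fin (n + 1) => ∫ X in boxConfig (n + 1) ℓ u, ‖nbodyQ ℓ u k Φ X‖ ^ 2)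
    beta_reduce at hs
    rw [hs, hK₁r] at h
    have hid : (2 * ((ℓ ^ 3)⁻¹ * ((16 * Real.pi * Cχ ^ 2) * (scatteringLength v).toReal))) * (2 * (((n + 1 : ℕ) : ℝ) - 1) * (∑ k : Fin (n + 1), ∫ X in boxConfig (n + 1) ℓ u, ‖nbodyQ ℓ u k Φ X‖ ^ 2)) =
        4 * ((ℓ ^ 3)⁻¹ * ((16 * Real.pi * Cχ ^ 2) * (scatteringLength v).toReal)) * (((n + 1 : ℕ) : ℝ) - 1) * (∑ k : Fin (n + 1), ∫ X in boxConfig (n + 1) ℓ u, ‖nbodyQ ℓ u k Φ X‖ ^ 2) := by ring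
    linarith [h, hid]
  -- the cross terms
  have hCr : (∑ i : Fin (n + 1), ∑ j : Fin (n + 1) with j ≠ i, ∫ X in boxConfig (n + 1) ℓ u, (pairLoc₁ v ω χ ℓ u (X i) (X j)).toReal * (conj (nbodyP ℓ u i (nbodyP ℓ u j Φ) X) * (Φ X - nbodyP ℓ u i (nbodyP ℓ u j Φ) X - nbodyQ ℓ u j (nbodyQ ℓ u i Φ) X)).re) = 2 * ((ℓ ^ 3)⁻¹ * (∑ i : Fin (n + 1), ∑ j : Fin (n + 1) with j ≠ i, ∫ X in boxConfig (n + 1) ℓ u, (∫⁻ y, pairLoc₁ v ω χ ℓ u (X j) y).toReal * (conj (nbodyP ℓ u i (nbodyP ℓ u j Φ) X) * nbodyQ ℓ u j Φ X).re)) := by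
    have h : ∀ i, ∀ j ∈ Finset.univ.filter (fun j => j ≠ i), ∫ X in boxConfig (n + 1) ℓ u, (pairLoc₁ v ω χ ℓ u (X i) (X j)).toReal * (conj (nbodyP ℓ u i (nbodyP ℓ u j Φ) X) * (Φ X - nbodyP ℓ u i (nbodyP ℓ u j Φ) X - nbodyQ ℓ u j (nbodyQ ℓ u i Φ) X)).re = (ℓ ^ 3)⁻¹ * (∫ X in boxConfig (n + 1) ℓ u, (∫⁻ y, pairLoc₁ v ω χ ℓ u (X j) y).toReal * (conj (nbodyP ℓ u i (nbodyP ℓ u j Φ) X) * nbodyQ ℓ u j Φ X).re) + (ℓ ^ 3)⁻¹ * (∫ X in boxConfig (n + 1) ℓ u, (∫⁻ y, pairLoc₁ v ω χ ℓ u (X i) y).toReal * (conj (nbodyP ℓ u i (nbodyP ℓ u j Φ) X) * nbodyQ ℓ u i Φ X).re) :=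
      fun i j hj => integral_pairLoc₁_cross_eq hℓ hω hχ hvm hK₁ hK₁' hΦm hΦ2 (hne i j hj)
    rw [Finset.sum_congr rfl fun i _ => Finset.sum_congr rfl (h i)]
    simp only [Finset.sum_add_distrib, ← Finset.mul_sum]
    have hsc := sum_cross_comm hΦm hΦ2 (fun x => (∫⁻ y, pairLoc₁ v ω χ ℓ u x y).toReal) (ℓ := ℓ) (u := u)
    beta_reduce at hsc
    rw [hsc]
    ring
  -- the attraction
  have hAttr : (∫⁻ X in boxConfig (n + 1) ℓ u, attrBoxN v ω χ ℓ ρμ u X * (‖Φ X‖₊ : ℝ≥0∞) ^ 2).toReal = ρμ * (8 * Real.pi * (scatteringLength v).toReal * (∑ k : Fin (n + 1), ∫ X in boxConfig (n + 1) ℓ u, ‖nbodyP ℓ u k Φ X‖ ^ 2) + (∑ k : Fin (n + 1), ∫ X in boxConfig (n + 1) ℓ u, (∫⁻ y, pairLoc₁ v ω χ ℓ u (X k) y).toReal * ‖nbodyQ ℓ u k Φ X‖ ^ 2) + 2 * (∑ k : Fin (n + 1), ∫ X in boxConfig (n + 1) ℓ u, (∫⁻ y, pairLoc₁ v ω χ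 ℓ u (X k) y).toReal * (conj (nbodyP ℓ u k Φ X) * nbodyQ ℓ u k Φ X).re)) := by
    rw [hAttr0, Finset.sum_congr rfl fun k _ => integral_attr_split hℓ hω hχ hvm hsL hR hD hRℓ hK₁ hK₁' hΦm hΦ2 k]
    simp only [Finset.sum_add_distrib, ← Finset.mul_sum]
  have hSP : (∑ k : Fin (n + 1), ∫ X in boxConfig (n + 1) ℓ u, ‖nbodyP ℓ u k Φ X‖ ^ 2) ≤ ((n + 1 : ℕ) : ℝ) * ∫ X in boxConfig (n + 1) ℓ u, ‖Φ X‖ ^ 2 := by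
    have h0 : ∀ k ∈ (Finset.univ : Finset (Fin (n + 1))), ∫ X in boxConfig (n + 1) ℓ u, ‖nbodyP ℓ u k Φ X‖ ^ 2 ≤ ∫ X in boxConfig (n + 1) ℓ u, ‖Φ X‖ ^ 2 := by
      intro k _
      rw [integral_norm_sq_eq_toReal (measurable_nbodyP ℓ u k hΦm).aestronglyMeasurable,
        integral_norm_sq_eq_toReal hΦm.aestronglyMeasurable]
      exact ENNReal.toReal_mono hN2 (lintegral_nbodyP_sq_le hℓ k hΦm)
    have h := Finset.sum_le_sum h0
    rw [Finset.sum_const, Finset.card_univ, Fintype.card_fin, nsmul_eq_mul] at h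
    exact h
  have hSQ : (∑ k : Fin (n + 1), ∫ X in boxConfig (n + 1) ℓ u, (∫⁻ y, pairLoc₁ v ω χ ℓ u (X k) y).toReal * ‖nbodyQ ℓ u k Φ X‖ ^ 2) ≤ (16 * Real.pi * Cχ ^ 2) * (scatteringLength v).toReal * (∑ k : Fin (n + 1), ∫ X in boxConfig (n + 1) ℓ u, ‖nbodyQ ℓ u k Φ X‖ ^ 2) := by
    rw [Finset.mul_sum, ← hK₁r]
    exact Finset.sum_le_sum fun k _ => integral_attr_mul_norm_sq_le hω hχ hℓ hK₁ hK₁' (memLp_nbodyQ hℓ k hΦm hΦ2) k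
  have hN20 : 0 ≤ ∫ X in boxConfig (n + 1) ℓ u, ‖Φ X‖ ^ 2 := integral_nonneg fun X => by positivity
  have hNq0 : 0 ≤ (∑ k : Fin (n + 1), ∫ X in boxConfig (n + 1) ℓ u, ‖nbodyQ ℓ u k Φ X‖ ^ 2) := Finset.sum_nonneg fun k _ => integral_nonneg fun X => by positivity
  have hSP0 : 0 ≤ (∑ k : Fin (n + 1), ∫ X in boxConfig (n + 1) ℓ u, ‖nbodyP ℓ u k Φ X‖ ^ 2) := Finset.sum_nonneg fun k _ => integral_nonneg fun X => by positivity
  have f1 : 8 * Real.pi * (scatteringLength v).toReal * ρμ * (∑ k : Fin (n + 1), ∫ X in boxConfig (n + 1) ℓ u, ‖nbodyP ℓ u k Φ X‖ ^ 2) ≤ 8 * Real.pi * (scatteringLength v).toReal * ρμ * (((n + 1 : ℕ) : ℝ) * ∫ X in boxConfig (n + 1) ℓ u, ‖Φ X‖ ^ 2) :=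
    mul_le_mul_of_nonneg_left hSP (by positivity)
  have f3 : ρμ * (∑ k : Fin (n + 1), ∫ X in boxConfig (n + 1) ℓ u, (∫⁻ y, pairLoc₁ v ω χ ℓ u (X k) y).toReal * ‖nbodyQ ℓ u k Φ X‖ ^ 2) ≤ ρμ * ((16 * Real.pi * Cχ ^ 2) * (scatteringLength v).toReal * (∑ k : Fin (n + 1), ∫ X in boxConfig (n + 1) ℓ u, ‖nbodyQ ℓ u k Φ X‖ ^ 2)) := mul_le_mul_of_nonneg_left hSQ hρ.le
  -- the completed square
  have hlam : 0 < (ℓ ^ 3 / (4 * ((n + 1 : ℕ) : ℝ))) := by positivity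
  have hOneQ : -((ℓ ^ 3 / (4 * ((n + 1 : ℕ) : ℝ))) * (8 * Real.pi * (scatteringLength v).toReal) * (((((n + 1 : ℕ) : ℝ) - 1) * (ℓ ^ 3)⁻¹ - ρμ) ^ 2 * (∑ k : Fin (n + 1), ∫ X in boxConfig (n + 1) ℓ u, ‖nbodyP ℓ u k Φ X‖ ^ 2) + (2 * |((((n + 1 : ℕ) : ℝ) - 1) * (ℓ ^ 3)⁻¹ - ρμ)| * (ℓ ^ 3)⁻¹ + (ℓ ^ 3)⁻¹ ^ 2 * (((n + 1 : ℕ) : ℝ) - 1)) * ((((n + 1 : ℕ) : ℝ) - 1) * (∑ k : Fin (n + 1), ∫ X in boxConfig (n + 1) ℓ u, ‖nbodyQ ℓ u k Φ X‖ ^ 2)))) -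
      (ℓ ^ 3 / (4 * ((n + 1 : ℕ) : ℝ)))⁻¹ * ((16 * Real.pi * Cχ ^ 2) * (scatteringLength v).toReal) * (∑ k : Fin (n + 1), ∫ X in boxConfig (n + 1) ℓ u, ‖nbodyQ ℓ u k Φ X‖ ^ 2) ≤ 2 * ((ℓ ^ 3)⁻¹ * (∑ i : Fin (n + 1), ∑ j : Fin (n + 1) with j ≠ i, ∫ X in boxConfig (n + 1) ℓ u, (∫⁻ y, pairLoc₁ v ω χ ℓ u (X j) y).toReal * (conj (nbodyP ℓ u i (nbodyP ℓ u j Φ) X) * nbodyQ ℓ u j Φ X).re)) - 2 * (ρμ * (∑ k : Fin (n + 1), ∫ X in boxConfig (n + 1) ℓ u, (∫⁻ y, pairLoc₁ v ω χ ℓ u (X k) y).toReal * (conj (nbodyP ℓ u k Φ X) * nbodyQ ℓ u k Φ X).re)) := by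
    -- per particle
    have hper : ∀ k ∈ (Finset.univ : Finset (Fin (n + 1))),
        -((ℓ ^ 3 / (4 * ((n + 1 : ℕ) : ℝ))) * (8 * Real.pi * (scatteringLength v).toReal) * (((((n + 1 : ℕ) : ℝ) - 1) * (ℓ ^ 3)⁻¹ - ρμ) ^ 2 * (∫ X in boxConfig (n + 1) ℓ u, ‖nbodyP ℓ u k Φ X‖ ^ 2))) -
            (ℓ ^ 3 / (4 * ((n + 1 : ℕ) : ℝ))) * (8 * Real.pi * (scatteringLength v).toReal) * ((2 * |((((n + 1 : ℕ) : ℝ) - 1) * (ℓ ^ 3)⁻¹ - ρμ)| * (ℓ ^ 3)⁻¹ + (ℓ ^ 3)⁻¹ ^ 2 * (((n + 1 : ℕ) : ℝ) - 1)) * (∑ i : Fin (n + 1) with i ≠ k, ∫ X in boxConfig (n + 1) ℓ u, ‖nbodyQ ℓ u i Φ X‖ ^ 2)) -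
          (ℓ ^ 3 / (4 * ((n + 1 : ℕ) : ℝ)))⁻¹ * ((16 * Real.pi * Cχ ^ 2) * (scatteringLength v).toReal) * (∫ X in boxConfig (n + 1) ℓ u, ‖nbodyQ ℓ u k Φ X‖ ^ 2) ≤
        2 * ((ℓ ^ 3)⁻¹ * (∑ i : Fin (n + 1) with i ≠ k,
            ∫ X in boxConfig (n + 1) ℓ u, (∫⁻ y, pairLoc₁ v ω χ ℓ u (X k) y).toReal * (conj (nbodyP ℓ u i (nbodyP ℓ u k Φ) X) * nbodyQ ℓ u k Φ X).re)) -
          2 * (ρμ * (∫ X in boxConfig (n + 1) ℓ u, (∫⁻ y, pairLoc₁ v ω χ ℓ u (X k) y).toReal * (conj (nbodyP ℓ u k Φ X) * nbodyQ ℓ u k Φ X).re)) := by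
      intro k _
      have hUkm : Measurable fun X : Config (n + 1) => (∫⁻ y, pairLoc₁ v ω χ ℓ u (X k) y).toReal := (hUm.comp (measurable_pi_apply k)).ennreal_toReal
      have hU0 : ∀ X : Config (n + 1), 0 ≤ (∫⁻ y, pairLoc₁ v ω χ ℓ u (X k) y).toReal := fun X => ENNReal.toReal_nonneg
      have hUc : ∀ X : Config (n + 1), (∫⁻ y, pairLoc₁ v ω χ ℓ u (X k) y).toReal ≤ (ENNReal.ofReal Cχ * ENNReal.ofReal Cχ * 2 * (ENNReal.ofReal (8 * Real.pi) * scatteringLength v)).toReal := fun X => ENNReal.toReal_mono hK₁' (hUb _)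
      have hUc' : ∀ X : Config (n + 1), ‖(∫⁻ y, pairLoc₁ v ω χ ℓ u (X k) y).toReal‖ ≤ (ENNReal.ofReal Cχ * ENNReal.ofReal Cχ * 2 * (ENNReal.ofReal (8 * Real.pi) * scatteringLength v)).toReal := fun X => by
        rw [Real.norm_of_nonneg (hU0 X)]; exact hUc X
      have hAm := measurable_oneQ_A ℓ u ρμ k hΦm
      have hA2 := memLp_oneQ_A hℓ ρμ k hΦm hΦ2 (u := u)
      have hQ2 := memLp_nbodyQ hℓ k hΦm hΦ2
      have hcollect := integral_oneQ_collect hUkm hUc' hℓ hΦm hΦ2 ρμ k (u := u)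
      have hcs := integral_cs_oneQ hUkm hU0 hUc hA2 hQ2 hlam (u := u)
      have hAw := integral_attr_mul_norm_sq_eq hℓ hω hχ hvm hsL hR hD hRℓ k hAm (oneQ_A_update ℓ u ρμ k Φ) hA2
      have hAn := integral_norm_sq_oneQ_A_le hℓ hΦm hΦ2 ρμ k (u := u)
      have hUQ := integral_attr_mul_norm_sq_le hω hχ hℓ hK₁ hK₁' hQ2 k
      rw [hK₁r] at hUQ
      rw [hcollect, hAw] at hcs
      have e1 := mul_le_mul_of_nonneg_left hAn (by positivity : (0 : ℝ) ≤ (ℓ ^ 3 / (4 * ((n + 1 : ℕ) : ℝ))) * (8 * Real.pi * (scatteringLength v).toReal))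
      have e2 := mul_le_mul_of_nonneg_left hUQ (inv_pos.mpr hlam).le
      linarith [hcs, e1, e2]
    have h := Finset.sum_le_sum hper
    simp only [Finset.sum_sub_distrib, Finset.sum_neg_distrib, ← Finset.mul_sum] at h
    have hsr := sum_sum_filter_ne_right (m := n + 1) (fun i => ∫ X in boxConfig (n + 1) ℓ u, ‖nbodyQ ℓ u i Φ X‖ ^ 2)
    beta_reduce at hsr
    rw [hsr] at h
    have hsw := sum_sum_filter_ne_comm (m := n + 1)
      (fun i j => ∫ X in boxConfig (n + 1) ℓ u, (∫⁻ y, pairLoc₁ v ω χ ℓ u (X j) y).toReal * (conj (nbodyP ℓ u i (nbodyP ℓ u j Φ) X) * nbodyQ ℓ u j Φ X).re)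
    beta_reduce at hsw
    rw [hsw]
    linarith [h]
  have f2 : (ℓ ^ 3 / (4 * ((n + 1 : ℕ) : ℝ))) * (8 * Real.pi * (scatteringLength v).toReal) * ((((n + 1 : ℕ) : ℝ) - 1) * (ℓ ^ 3)⁻¹ - ρμ) ^ 2 * (∑ k : Fin (n + 1), ∫ X in boxConfig (n + 1) ℓ u, ‖nbodyP ℓ u k Φ X‖ ^ 2) ≤
      (ℓ ^ 3 / (4 * ((n + 1 : ℕ) : ℝ))) * (8 * Real.pi * (scatteringLength v).toReal) * ((((n + 1 : ℕ) : ℝ) - 1) * (ℓ ^ 3)⁻¹ - ρμ) ^ 2 * (((n + 1 : ℕ) : ℝ) * ∫ X in boxConfig (n + 1) ℓ u, ‖Φ X‖ ^ 2) :=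
    mul_le_mul_of_nonneg_left hSP (by positivity)
  -- coefficients
  have P1 := mul_le_mul_of_nonneg_right
    (eq225_coefN2 ha hℓ hρ hm1 hJ0 hJ (lam := (ℓ ^ 3 / (4 * ((n + 1 : ℕ) : ℝ)))) rfl (α := ((((n + 1 : ℕ) : ℝ) - 1) * (ℓ ^ 3)⁻¹ - ρμ)) rfl) hN20
  have P2 := mul_le_mul_of_nonneg_right
    (eq225_coefNp ha hℓ hρ hm1 hk0 hJ0 hJ (lam := (ℓ ^ 3 / (4 * ((n + 1 : ℕ) : ℝ)))) rfl (α := ((((n + 1 : ℕ) : ℝ) - 1) * (ℓ ^ 3)⁻¹ - ρμ)) rfl (cA := (2 * |((((n + 1 : ℕ) : ℝ) - 1) * (ℓ ^ 3)⁻¹ - ρμ)| * (ℓ ^ 3)⁻¹ + (ℓ ^ 3)⁻¹ ^ 2 * (((n + 1 : ℕ) : ℝ) - 1))) rfl) hNq0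
  have g1 : 0 ≤ (scatteringLength v).toReal * (ρμ + ((n + 1 : ℕ) : ℝ) * (ℓ ^ 3)⁻¹) * ∫ X in boxConfig (n + 1) ℓ u, ‖Φ X‖ ^ 2 := by positivity
  have g1' : 0 ≤ (16 * Real.pi * Cχ ^ 2) * ((scatteringLength v).toReal * (ρμ + ((n + 1 : ℕ) : ℝ) * (ℓ ^ 3)⁻¹) * ∫ X in boxConfig (n + 1) ℓ u, ‖Φ X‖ ^ 2) := by positivity
  have g2 : 0 ≤ (scatteringLength v).toReal * (ρμ + ((n + 1 : ℕ) : ℝ) * (ℓ ^ 3)⁻¹) * (∑ k : Fin (n + 1), ∫ X in boxConfig (n + 1) ℓ u, ‖nbodyQ ℓ u k Φ X‖ ^ 2) := by positivity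
  have hfinal := eq225_combine (E := (((n + 1 : ℕ) : ℝ) ^ 2 / (2 * ℓ ^ 3) * (8 * Real.pi * (scatteringLength v).toReal + (gOmegaIntegral v ω).toReal) - (ρμ * ((n + 1 : ℕ) : ℝ) / ℓ ^ 3 + 4⁻¹ * (ρμ - ((n + 1 : ℕ) : ℝ) / ℓ ^ 3) ^ 2) * (8 * Real.pi * (scatteringLength v).toReal * ℓ ^ 3))) hRep hPair hT0 hT2 hCr hAttr f1 f3 hOneQ f2 P1 P2 g1 g1' g2
  rw [hA2, hN2r, hNp, div_eq_mul_inv ((n + 1 : ℕ) : ℝ) (ℓ ^ 3)]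
  exact hfinal

end Succ

/-! ### Lemma 2.3 in the form (2.25), proved -/

section Main

/-- **Fournais 2020, (2.25) (Lemma 2.3 = [FournaisSolovej2020, Lemma B.2]), proved**: on the
`n`-particle sector of the box `Λ(u)` (`R/ℓ` small),
`-ρ_μ∑ᵢ∫w₁(xᵢ,y)dy + ½∑_{i≠j}w(xᵢ,xⱼ) ≥ A₂ + (n²/(2ℓ³))(8πa + ∫gω) - (ρ_μn/ℓ³ + ¼(ρ_μ - n/ℓ³)²)8πaℓ³ - Ca(ρ_μ + n/ℓ³)(n₊ + 1)`
in every measurable `Φ` with finite forms, with `C = 32π + 128π‖χ‖²_∞` and `c₁ = D` (`χ*χ ≥ ½`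
on `B̄(0,D)`). The proof is the first-quantised potential-energy decomposition: the pointwise
inequality `pointwise_pair_ineq` per ordered pair (Lemma 2.2 with the Cauchy–Schwarz absorptions
of (2.22)), the `0Q` term integrated out exactly ((2.10), `‖PᵢPⱼΦ‖² ≥ ‖Φ‖² - ‖QᵢΦ‖² - ‖QⱼΦ‖²`),
the one-`Q` terms collected into `A_j = ℓ⁻³∑_{i≠j}PᵢPⱼΦ - ρ_μPⱼΦ` and completed to a square
(`λ = ℓ³/(4n)`), and the `2Q` errors bounded by `sup_x∫w₁(x,y)dy ≤ 2‖χ‖²_∞8πa`; the symmetry of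
`Φ` is not used. [cite: Fournais2020, (2.25), Lemma 2.3 (2.22)–(2.24), Lemma 2.2 (2.16)–(2.21), (2.10)]
[cite: FournaisSolovej2020, Lemma B.2] -/
theorem Fournais2020_eq225_holds : Fournais2020_eq225 := by
  intro v hv hvi hsL0 ω hω χ hχ R hR0 hR
  obtain ⟨Cχ, hCχ⟩ := hχ.exists_bound
  obtain ⟨D, hD0, hD⟩ := exists_selfConv_ge_half hχ
  have hsL : scatteringLength v ≠ ⊤ := by
    refine scatteringLength_ne_top ?_
    rw [lintegral_const_mul' _ _ (ENNReal.inv_ne_top.2 two_ne_zero)]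
    exact ENNReal.mul_ne_top (ENNReal.inv_ne_top.2 two_ne_zero) hvi
  refine ⟨32 * Real.pi + 8 * (16 * Real.pi * Cχ ^ 2), D, by positivity, hD0, ?_⟩
  intro ℓ ρμ hℓ hρ hRℓ
  dsimp only
  intro n u Φ hΦm _hΦs hN2 hrep _hattr _hNp
  have hRD : R / ℓ ≤ D := by rwa [div_le_iff₀ hℓ]
  cases n with
  | zero =>
    have ha0 : 0 ≤ (scatteringLength v).toReal := ENNReal.toReal_nonneg
    have hN0 : 0 ≤ (∫⁻ X in boxConfig 0 ℓ u, (‖Φ X‖₊ : ℝ≥0∞) ^ 2).toReal := ENNReal.toReal_nonneg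
    have hrep0 : (∫⁻ X in boxConfig 0 ℓ u, repBoxN v χ ℓ u X * (‖Φ X‖₊ : ℝ≥0∞) ^ 2) = 0 := by
      simp [repBoxN]
    have hattr0 : (∫⁻ X in boxConfig 0 ℓ u, attrBoxN v ω χ ℓ ρμ u X * (‖Φ X‖₊ : ℝ≥0∞) ^ 2) = 0 := by
      simp [attrBoxN]
    have ha2 : a2Form v ω χ ℓ u Φ = 0 := by simp [a2Form]
    rw [hrep0, hattr0, ha2, nPlusBoxN_zero]
    simp only [ENNReal.toReal_zero, Nat.cast_zero, zero_div, mul_zero, zero_add, add_zero, sub_zero,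
      zero_mul, zero_pow two_ne_zero, sub_self]
    nlinarith [mul_nonneg (by positivity : (0 : ℝ) ≤ 4⁻¹ * ρμ ^ 2 * (8 * Real.pi * (scatteringLength v).toReal * ℓ ^ 3)) hN0,
      mul_nonneg (by positivity : (0 : ℝ) ≤ (32 * Real.pi + 8 * (16 * Real.pi * Cχ ^ 2)) *
        (scatteringLength v).toReal * ρμ) hN0]
  | succ n =>
    exact eq225_succ hℓ hω hχ hv.1 hsL hsL0 hR hCχ hD hRD hvi hρ hΦm hN2 hrep

end Main

end Literature.MathematicalPhysics.QuantumManyBody.BoseGas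

end
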